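import Mathlib
import HarnessLib

/-!
# The second spacing lemma of the Bombieri–Iwaniec method (Graham–Kolesnik, Lemmas 7.17–7.18), PROVED

Topic `Literature/NumberTheory/LFunctions`. This file proves, sorry-free, the elementary "second
spacing lemma" of the Bombieri–Iwaniec method for exponential sums in the form printed by
Graham–Kolesnik, *Van der Corput's Method of Exponential Sums* (LMS Lecture Note Series 126, CUP 1991),
§7.5 "Lemmas on rational points", Lemma 7.17 (the transition matrix between two rationals) and
Lemma 7.18 (the count `B`), pp. 66–69 of the copy read:

* **Lemma 7.17.** If `r/q`, `r₁/q₁` are in lowest terms and `|r̄/q - r̄₁/q₁| ≤ Δ` (`r r̄ ≡ 1 (q)`,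
  `r₁ r̄₁ ≡ 1 (q₁)`), there are integers `a, b, c, d` with `ad - bc = 1`,
  `(r₁, q₁)ᵀ = (a b; c d)(r, q)ᵀ`, `a = (c r₁ + q)/q₁`, `d = (q₁ - c r)/q`,
  `b = (-c r r₁ + r₁ q₁ - r q)/(q q₁)` and `|c| ≤ Δ q q₁` (`exists_transitionMatrix`,
  `transitionMatrix_entries`, `exists_tmat_of_invClose`).
* **Lemma 7.18.** Let `A, C ≥ 1`, `0 ≤ Δ₁, Δ₂`, `I ⊆ [A/2C, 2A/C]` an interval, `h` differentiable on
  `I` with `H/C₀ ≤ h`, `H/C₀ ≤ |x h'(x)| ≤ C₀ H`, `H/C₀ ≤ |h(x) - x h'(x)|` on `I` (`IsSpacingFn`; the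
  printed hypotheses `h ≤ C₀H`, `|h - xh'| ≤ C₀H` are not needed). Let `B` (`pairCount`) be the
  number of pairs of reduced fractions `r/q, r₁/q₁ ∈ I` with `A < r, r₁ ≤ 2A`, `C < q, q₁ ≤ 2C`
  (7.5.4), `‖r̄/q - r̄₁/q₁‖ ≤ Δ₁` (7.5.2) and `|q h(r/q) - q₁ h(r₁/q₁)| ≤ C H Δ₂` (7.5.3). Then
  (`GrahamKolesnik_lemma718_general`)
  `B ≪_{C₀} (Δ₁Δ₂ + Δ₁²) A C² (A + C) + A C + Δ₂ A² + Δ₂ C²`,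
  and hence, when `C ≤ K₁ A` (`GrahamKolesnik_lemma718`), the printed bound
  `B ≪_{C₀,K₁} Δ₁Δ₂A²C² + Δ₁²A²C² + AC + Δ₂A² + Δ₂C²`.
  An explicit admissible constant is recorded in `pairCount_le`.

**On the proviso `C ≪ A`.** The last display of the printed proof counts, for `Y < |c| ≤ 2Y`, the
unimodular matrices with `|a|, |d| ≤ 50 X Y` (`X = A/5C`) and `ad ≡ 1 (mod c)` as `≪ X²Y²|c|⁻¹`,
which drops a term `X Y` and is valid when `X ≫ 1`, i.e. `A ≫ C` ("Note that `X ≫ 1` because of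
(7.5.6)" — (7.5.6) only gives `X|c| ≫ 1`). It holds in the applications to `ζ(1/2 + it)` (there
`A ≍ C F M⁻²` with `F = T ≥ M²`; in Bourgain's (3.11): `A ≍ Q T/M²`, `C ≍ Q`, `M ≤ √T`); without it
the same argument gives the general bound above, with `A C² (A + C)` in place of `A² C²` in the first
two terms. We prove the general bound and deduce the printed one under `C ≤ K₁ A`; nothing is assumed
beyond the printed hypotheses otherwise.

This is the lemma behind the bound `B₁ ≪ Δ₁ Δ₂ (M/N)² (Q/R)⁴` for the second spacing problem in
§4, (3.11) of Bourgain, *JAMS* 30 (2017) (there taken from Huxley–Watt 1988, who take it from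
Bombieri–Iwaniec 1986): with numerators `A ≍ QT/M²`, denominators `C ≍ Q` and `R² ≍ M³/(NT)` one has
`(M/N)²(Q/R)⁴ = Q⁴T²/M⁴ ≍ A²C²`. It is step 4 of the printed proof of Bourgain's Theorem 4
(`Literature/NumberTheory/LFunctions/BourgainTheorem4.lean`, docstring); steps 2 (double large sieve,
`DoubleLargeSieve.lean`), 3 (first spacing count) and 6 are proved there and in the files it cites.

## Proof (Graham–Kolesnik's, pp. 67–69, made quantitative)

Each counted pair determines (Lemma 7.17) a matrix `γ = (a b; c d) ∈ SL₂(ℤ)` with `γ(r, q) = (r₁, q₁)`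
and `|c| ≤ Δ₁ q q₁ ≤ 4Δ₁C²` (`mat`, `goodPair_facts`); the pair is recovered from `(γ, r/q)`.
* `c = 0`: `γ = (1 b; 0 1)`, and the mean value theorem for `h` gives `|b| ≤ 2C₀AΔ₂/C` (`caseC`);
* `b = 0`: `γ = (1 0; c 1)`, and the mean value theorem for `h(u)/u` gives `|c| ≤ 16C₀CΔ₂/A` (`caseB`);
* `a = 0` / `d = 0`: `γ = (0 1; -1 d)` with `1 ≤ d ≤ 3` / `γ = (a -1; 1 0)` with `1 ≤ a ≤ 3` (`caseA`,
  `caseD`);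
* `abcd ≠ 0`, `|bc| < D`: all entries are `≤ D` (`caseSmall`), `D = ⌈576 C₀⁴ + 48 C₀²⌉`;
* `|bc| ≥ D = 4W² + 4W`, `W = 12C₀²`: then `w = |c|A/C ≥ W` and `|a|, |d| ≤ 4|c|A/C` (`caseBig`,
  (7.5.6)–(7.5.9)); for a fixed such `γ` all the `r/q` lie in an interval of length `4C₀Δ₂/|c|`
  (`fiber_diam`: the function `g(x) = (cx + d) h(γx) - h(x)` has `|g| ≤ HΔ₂` at each such point and
  `|g'| ≥ |c|H/(2C₀)` between two of them, (7.5.10)–(7.5.11)), so there are `≤ 16C₀C²Δ₂/|c| + 1` of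
  them (`fiber_card_le`, reduced fractions being `1/(4C²)`-spaced); and the matrices with given `c`
  number `≤ (8|c|A/C + 1)(8A/C + 1)` (`card_fixed_c_le`: for fixed `a`, the `d`'s lie in one residue
  class mod `c`), which sums to `≪ (Δ₁² + Δ₁Δ₂)(A²C² + AC³)` over `0 < |c| ≤ 4Δ₁C²` (`sum_big_le`).

## Content (namespace `Literature.NumberTheory.LFunctions.SecondSpacing`; everything PROVED)

* `TMat` (integer `2×2` matrices: `det`, `apply`, the Möbius map `moeb`, `moeb_sub`, `hasDerivAt_moeb`),
  `exists_transitionMatrix`, `transitionMatrix_entries` — Lemma 7.17.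
* `points` (`𝓟(A,C,I)`, (7.5.4)), `points_spacing`, `card_points_le`; `InvClose` ((7.5.2)), `HClose`
  ((7.5.3)), `goodPairs`, `pairCount` (`B`); `IsSpacingFn` (hypotheses on `h`) with the mean-value
  bounds `h_sub_h`, `k_sub_k`; `mat`, `goodPair_facts`.
* `caseC`, `caseB`, `caseA`, `caseD`, `caseSmall`, `caseBig`, `fiber_diam`, `fiber_card_le`,
  `card_le_of_key`, `card_fixed_c_le`, `sum_big_le` — the steps above; tools `mvt_abs_lower(_within)`,
  `card_le_of_spacing` (well-spaced finite sets of reals), `card_filter_modEq_le`.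
* `pairCount_le` (explicit), `GrahamKolesnik_lemma718_general`, `GrahamKolesnik_lemma718` — Lemma 7.18.

## References

* S. W. Graham, G. Kolesnik, *Van der Corput's Method of Exponential Sums*, LMS Lecture Note Series
  126, Cambridge Univ. Press 1991, doi:10.1017/cbo9780511661976 — §7.5, Lemma 7.17, Lemma 7.18
  (pp. 66–69). [GrahamKolesnik1991]
* E. Bombieri, H. Iwaniec, *On the order of `ζ(1/2 + it)`*, Ann. Scuola Norm. Sup. Pisa (4) 13 (1986),
  449–472 — the original second spacing lemma. [BombieriIwaniec1986]
* M. N. Huxley, N. Watt, *Exponential sums and the Riemann zeta function*, Proc. London Math. Soc. (3)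
  57 (1988), 1–24. [HuxleyWatt1988]
* J. Bourgain, *Decoupling, exponential sums and the Riemann zeta function*, J. Amer. Math. Soc. 30
  (2017), 205–224 — §4, (3.9), (3.11). [BourgainJAMS2017]
-/

noncomputable section

open Finset Set
open scoped Real

namespace Literature.NumberTheory.LFunctions
namespace SecondSpacing

/-! ### Unimodular integer matrices acting on pairs and by Möbius maps -/

/-- An integer `2 × 2` matrix `(a b; c d)` (no determinant condition built in). [folklore] -/
@[ext] structure TMat where
  /-- upper left entry -/
  a : ℤ
  /-- upper right entry -/
  b : ℤ
  /-- lower left entry -/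
  c : ℤ
  /-- lower right entry -/
  d : ℤ
  deriving DecidableEq

namespace TMat

/-- Determinant `ad - bc`. [folklore] -/
def det (γ : TMat) : ℤ := γ.a * γ.d - γ.b * γ.c

/-- Action on integer column vectors `(r, q) ↦ (a r + b q, c r + d q)`. [folklore] -/
def apply (γ : TMat) (p : ℤ × ℤ) : ℤ × ℤ := (γ.a * p.1 + γ.b * p.2, γ.c * p.1 + γ.d * p.2)

/-- The Möbius map `t ↦ (a t + b) / (c t + d)` on `ℝ`. [folklore] -/
def moeb (γ : TMat) (t : ℝ) : ℝ := (γ.a * t + γ.b) / (γ.c * t + γ.d)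

/-- First component of the action. [folklore] -/
@[simp] theorem apply_fst (γ : TMat) (p : ℤ × ℤ) : (γ.apply p).1 = γ.a * p.1 + γ.b * p.2 := rfl

/-- Second component of the action. [folklore] -/
@[simp] theorem apply_snd (γ : TMat) (p : ℤ × ℤ) : (γ.apply p).2 = γ.c * p.1 + γ.d * p.2 := rfl

/-- The Möbius map sends `r/q` to `(a r + b q)/(c r + d q)`. [folklore] -/
theorem moeb_div (γ : TMat) {r q : ℝ} (hq : q ≠ 0) (hq₁ : (γ.c : ℝ) * r + γ.d * q ≠ 0) :
    γ.moeb (r / q) = (γ.a * r + γ.b * q) / (γ.c * r + γ.d * q) := by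
  unfold moeb
  rw [div_eq_div_iff _ hq₁]
  · field_simp
  · intro h
    apply hq₁
    have : (γ.c : ℝ) * r + γ.d * q = ((γ.c : ℝ) * (r / q) + γ.d) * q := by field_simp
    rw [this, h, zero_mul]

/-- Difference formula for a unimodular Möbius map:
`γ s - γ t = (s - t) / ((c s + d)(c t + d))`. [folklore] -/
theorem moeb_sub (γ : TMat) (hγ : γ.det = 1) {s t : ℝ} (hs : (γ.c : ℝ) * s + γ.d ≠ 0)
    (ht : (γ.c : ℝ) * t + γ.d ≠ 0) :
    γ.moeb s - γ.moeb t = (s - t) / ((γ.c * s + γ.d) * (γ.c * t + γ.d)) := by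
  have hdet : (γ.a : ℝ) * γ.d - γ.b * γ.c = 1 := by exact_mod_cast hγ
  unfold moeb
  rw [div_sub_div _ _ hs ht, div_eq_div_iff (mul_ne_zero hs ht) (mul_ne_zero hs ht)]
  linear_combination (s - t) * ((γ.c : ℝ) * s + γ.d) * ((γ.c : ℝ) * t + γ.d) * hdet

/-- Derivative of a unimodular Möbius map: `γ'(t) = 1/(c t + d)²`. [folklore] -/
theorem hasDerivAt_moeb (γ : TMat) (hγ : γ.det = 1) {t : ℝ} (ht : (γ.c : ℝ) * t + γ.d ≠ 0) :
    HasDerivAt γ.moeb (1 / ((γ.c : ℝ) * t + γ.d) ^ 2) t := by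
  have hdet : (γ.a : ℝ) * γ.d - γ.b * γ.c = 1 := by exact_mod_cast hγ
  have h1 : HasDerivAt (fun t : ℝ => (γ.a : ℝ) * t + γ.b) (γ.a : ℝ) t := by
    simpa using ((hasDerivAt_id t).const_mul (γ.a : ℝ)).add_const (γ.b : ℝ)
  have h2 : HasDerivAt (fun t : ℝ => (γ.c : ℝ) * t + γ.d) (γ.c : ℝ) t := by
    simpa using ((hasDerivAt_id t).const_mul (γ.c : ℝ)).add_const (γ.d : ℝ)
  have h3 := h1.div h2 ht
  have heq : ((γ.a : ℝ) * ((γ.c : ℝ) * t + γ.d) - ((γ.a : ℝ) * t + γ.b) * γ.c) /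
      ((γ.c : ℝ) * t + γ.d) ^ 2 = 1 / ((γ.c : ℝ) * t + γ.d) ^ 2 := by
    congr 1; linear_combination hdet
  rw [heq] at h3
  exact h3

end TMat

/-- **Graham–Kolesnik, Lemma 7.17 (transition matrix).** If `r u ≡ 1 (mod q)` and
`r₁ u₁ ≡ 1 (mod q₁)` then there is a unimodular integer matrix `(a b; c d)` with
`(r₁, q₁)ᵀ = (a b; c d)(r, q)ᵀ` and `c = q₁ u - q u₁`, i.e. `c = q q₁ (u/q - u₁/q₁)`; explicitly
`(a b; c d) = (r₁ -q̄₁; q₁ u₁)(u q̄; -q r)` where `q q̄ + r u = 1`, `q₁ q̄₁ + r₁ u₁ = 1`.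
[cite: GrahamKolesnik1991, Lemma 7.17 and eq. (7.5.1)] -/
theorem exists_transitionMatrix {r q u r₁ q₁ u₁ : ℤ} (hu : r * u ≡ 1 [ZMOD q])
    (hu₁ : r₁ * u₁ ≡ 1 [ZMOD q₁]) :
    ∃ γ : TMat, γ.det = 1 ∧ γ.apply (r, q) = (r₁, q₁) ∧ γ.c = q₁ * u - q * u₁ := by
  obtain ⟨k, hk⟩ := Int.modEq_iff_dvd.1 hu
  obtain ⟨k₁, hk₁⟩ := Int.modEq_iff_dvd.1 hu₁
  -- `q k + r u = 1`, `q₁ k₁ + r₁ u₁ = 1`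
  have h1 : q * k + r * u = 1 := by linarith
  have h2 : q₁ * k₁ + r₁ * u₁ = 1 := by linarith
  refine ⟨⟨r₁ * u + q * k₁, r₁ * k - r * k₁, q₁ * u - q * u₁, q₁ * k + r * u₁⟩, ?_, ?_, rfl⟩
  · unfold TMat.det
    linear_combination (q₁ * k₁ + r₁ * u₁) * h1 + h2
  · unfold TMat.apply
    simp only [Prod.mk.injEq]
    constructor
    · linear_combination r₁ * h1
    · linear_combination q₁ * h1

/-- The entries of a transition matrix in terms of `c` (Graham–Kolesnik, Lemma 7.17): if
`(r₁, q₁)ᵀ = γ (r, q)ᵀ` with `γ = (a b; c d)` unimodular then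
`a q₁ = c r₁ + q`, `d q = q₁ - c r`, `b q q₁ = -c r r₁ + r₁ q₁ - r q`. [cite: GrahamKolesnik1991, Lemma 7.17] -/
theorem transitionMatrix_entries (γ : TMat) (hγ : γ.det = 1) {p p₁ : ℤ × ℤ}
    (h : γ.apply p = p₁) :
    γ.a * p₁.2 = γ.c * p₁.1 + p.2 ∧ γ.d * p.2 = p₁.2 - γ.c * p.1 ∧
      γ.b * p.2 * p₁.2 = -γ.c * p.1 * p₁.1 + p₁.1 * p₁.2 - p.1 * p.2 := by
  obtain ⟨r, q⟩ := p
  simp only [TMat.apply, Prod.ext_iff] at h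
  obtain ⟨h₁, h₂⟩ := h
  simp only [← h₁, ← h₂]
  unfold TMat.det at hγ
  refine ⟨?_, ?_, ?_⟩
  · linear_combination q * hγ
  · ring
  · linear_combination (-(q * r)) * hγ

/-! ### The configuration: reduced fractions `r/q` with `r ∼ A`, `q ∼ C`, `r/q ∈ I` -/

/-- The set `𝓟(A, C, I)` of pairs `(r, q) ∈ ℤ²` with `A < r ≤ 2A`, `C < q ≤ 2C`, `gcd(r, q) = 1` and
`r/q ∈ I` (Graham–Kolesnik (7.5.4), with the proviso that `h` is evaluated only on `I`).
[cite: GrahamKolesnik1991, Lemma 7.18, (7.5.4)] -/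
def points (A C : ℝ) (I : Set ℝ) : Finset (ℤ × ℤ) :=
  open Classical in
  ((Finset.Ioc ⌊A⌋ ⌊2 * A⌋) ×ˢ (Finset.Ioc ⌊C⌋ ⌊2 * C⌋)).filter
    fun p => IsCoprime p.1 p.2 ∧ (p.1 : ℝ) / p.2 ∈ I

/-- Membership in `𝓟(A, C, I)`. [folklore] -/
theorem mem_points {A C : ℝ} {I : Set ℝ} {p : ℤ × ℤ} :
    p ∈ points A C I ↔ (A < p.1 ∧ (p.1 : ℝ) ≤ 2 * A) ∧ (C < p.2 ∧ (p.2 : ℝ) ≤ 2 * C) ∧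
      IsCoprime p.1 p.2 ∧ (p.1 : ℝ) / p.2 ∈ I := by
  classical
  simp only [points, Finset.mem_filter, Finset.mem_product, Finset.mem_Ioc, Int.floor_lt,
    Int.le_floor]
  constructor
  · rintro ⟨⟨⟨h1, h2⟩, h3, h4⟩, h5, h6⟩
    exact ⟨⟨h1, by exact_mod_cast h2⟩, ⟨h3, by exact_mod_cast h4⟩, h5, h6⟩
  · rintro ⟨⟨h1, h2⟩, ⟨h3, h4⟩, h5, h6⟩
    exact ⟨⟨⟨h1, by exact_mod_cast h2⟩, h3, by exact_mod_cast h4⟩, h5, h6⟩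

/-- `#𝓟(A, C, I) ≤ (A + 1)(C + 1)`. [folklore] -/
theorem card_points_le {A C : ℝ} (hA : 0 ≤ A) (hC : 0 ≤ C) (I : Set ℝ) :
    ((points A C I).card : ℝ) ≤ (A + 1) * (C + 1) := by
  classical
  have h1 : ((points A C I).card : ℝ) ≤ ((Finset.Ioc ⌊A⌋ ⌊2 * A⌋) ×ˢ (Finset.Ioc ⌊C⌋ ⌊2 * C⌋)).card := by
    exact_mod_cast Finset.card_filter_le _ _
  refine h1.trans ?_
  rw [Finset.card_product, Nat.cast_mul, Int.card_Ioc, Int.card_Ioc]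
  have hA' : ((⌊2 * A⌋ - ⌊A⌋).toNat : ℝ) ≤ A + 1 := by
    have h0 : (⌊2 * A⌋ : ℝ) ≤ 2 * A := Int.floor_le _
    have h0' : (A : ℝ) < ⌊A⌋ + 1 := Int.lt_floor_add_one A
    rcases le_or_gt 0 (⌊2 * A⌋ - ⌊A⌋) with h | h
    · have : (((⌊2 * A⌋ - ⌊A⌋).toNat : ℤ) : ℝ) = ((⌊2 * A⌋ - ⌊A⌋ : ℤ) : ℝ) := by
        rw [Int.toNat_of_nonneg h]
      rw [Int.cast_natCast] at this
      rw [this]; push_cast; linarith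
    · rw [Int.toNat_eq_zero.2 h.le]; simp; linarith
  have hC' : ((⌊2 * C⌋ - ⌊C⌋).toNat : ℝ) ≤ C + 1 := by
    have h0 : (⌊2 * C⌋ : ℝ) ≤ 2 * C := Int.floor_le _
    have h0' : (C : ℝ) < ⌊C⌋ + 1 := Int.lt_floor_add_one C
    rcases le_or_gt 0 (⌊2 * C⌋ - ⌊C⌋) with h | h
    · have : (((⌊2 * C⌋ - ⌊C⌋).toNat : ℤ) : ℝ) = ((⌊2 * C⌋ - ⌊C⌋ : ℤ) : ℝ) := by
        rw [Int.toNat_of_nonneg h]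
      rw [Int.cast_natCast] at this
      rw [this]; push_cast; linarith
    · rw [Int.toNat_eq_zero.2 h.le]; simp; linarith
  exact mul_le_mul hA' hC' (Nat.cast_nonneg _) (by linarith)

/-- Distinct points of `𝓟(A, C, I)` give fractions at distance `≥ 1/(4C²)`. [folklore] -/
theorem points_spacing {A C : ℝ} {I : Set ℝ} {p p' : ℤ × ℤ} (hp : p ∈ points A C I)
    (hp' : p' ∈ points A C I) (hne : p ≠ p') (hC : 0 < C) :
    1 / (4 * C ^ 2) ≤ |(p.1 : ℝ) / p.2 - p'.1 / p'.2| := by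
  rw [mem_points] at hp hp'
  obtain ⟨-, ⟨hq1, hq2⟩, hcop, -⟩ := hp
  obtain ⟨-, ⟨hq1', hq2'⟩, hcop', -⟩ := hp'
  have hq : (0 : ℝ) < p.2 := hC.trans hq1
  have hq' : (0 : ℝ) < p'.2 := hC.trans hq1'
  have hqz : 0 < p.2 := by exact_mod_cast hq
  have hqz' : 0 < p'.2 := by exact_mod_cast hq'
  -- the numerator `r q' - r' q` is a nonzero integer
  have hnum : p.1 * p'.2 - p.2 * p'.1 ≠ 0 := by
    intro h0
    have hdvd : p.2 ∣ p.1 * p'.2 := ⟨p'.1, by linarith⟩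
    have h2 : p.2 ∣ p'.2 := hcop.symm.dvd_of_dvd_mul_left hdvd
    have hdvd' : p'.2 ∣ p'.1 * p.2 := ⟨p.1, by linarith⟩
    have h2' : p'.2 ∣ p.2 := hcop'.symm.dvd_of_dvd_mul_left hdvd'
    have heq : p.2 = p'.2 := Int.dvd_antisymm hqz.le hqz'.le h2 h2'
    have heq1 : p.1 = p'.1 := by
      rw [heq] at h0
      have : (p.1 - p'.1) * p'.2 = 0 := by linarith
      rcases mul_eq_zero.1 this with h | h
      · linarith
      · exact absurd h hqz'.ne'
    exact hne (Prod.ext heq1 heq)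
  have hnum' : (1 : ℝ) ≤ |(p.1 : ℝ) * p'.2 - p.2 * p'.1| := by
    have : (1 : ℤ) ≤ |p.1 * p'.2 - p.2 * p'.1| := Int.one_le_abs hnum
    exact_mod_cast this
  rw [div_sub_div _ _ hq.ne' hq'.ne', abs_div, abs_of_pos (mul_pos hq hq')]
  rw [div_le_div_iff₀ (by positivity) (mul_pos hq hq')]
  have hqq : (p.2 : ℝ) * p'.2 ≤ 4 * C ^ 2 := by nlinarith
  nlinarith

/-! ### Counting well-spaced points -/

/-- A finite set of reals of diameter `≤ L` whose distinct points are `≥ δ` apart has at most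
`L/δ + 1` elements. [folklore] -/
theorem card_le_of_spacing (S : Finset ℝ) {δ L : ℝ} (hδ : 0 < δ) (hL : 0 ≤ L)
    (hsep : ∀ x ∈ S, ∀ y ∈ S, x ≠ y → δ ≤ |x - y|) (hdiam : ∀ x ∈ S, ∀ y ∈ S, x - y ≤ L) :
    (S.card : ℝ) ≤ L / δ + 1 := by
  rcases S.eq_empty_or_nonempty with h | hne
  · rw [h]; simp; positivity
  set m := S.min' hne with hm
  have hmS : m ∈ S := S.min'_mem hne
  -- the map `x ↦ ⌊(x - m)/δ⌋₊` is injective on `S` with values `≤ ⌊L/δ⌋₊`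
  have hinj : Set.InjOn (fun x : ℝ => ⌊(x - m) / δ⌋₊) S := by
    intro x hx y hy hxy
    by_contra hne'
    have h1 := hsep x hx y hy hne'
    have hx0 : 0 ≤ (x - m) / δ := div_nonneg (by linarith [S.min'_le x hx]) hδ.le
    have hy0 : 0 ≤ (y - m) / δ := div_nonneg (by linarith [S.min'_le y hy]) hδ.le
    have h2 : ⌊(x - m) / δ⌋ = ⌊(y - m) / δ⌋ := by
      have := congrArg (fun n : ℕ => (n : ℤ)) hxy
      simpa [Int.natCast_floor_eq_floor hx0, Int.natCast_floor_eq_floor hy0] using this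
    have h3 := Int.abs_sub_lt_one_of_floor_eq_floor h2
    rw [← sub_div, abs_div, abs_of_pos hδ, div_lt_one hδ] at h3
    have : x - m - (y - m) = x - y := by ring
    rw [this] at h3
    linarith
  have hmaps : ∀ x ∈ S, (fun x : ℝ => ⌊(x - m) / δ⌋₊) x ∈ Finset.range (⌊L / δ⌋₊ + 1) := by
    intro x hx
    rw [Finset.mem_range, Nat.lt_add_one_iff]
    apply Nat.floor_le_floor
    exact div_le_div_of_nonneg_right (by linarith [hdiam x hx m hmS]) hδ.le
  have hcard := Finset.card_le_card_of_injOn _ hmaps hinj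
  rw [Finset.card_range] at hcard
  calc (S.card : ℝ) ≤ ((⌊L / δ⌋₊ + 1 : ℕ) : ℝ) := by exact_mod_cast hcard
    _ = (⌊L / δ⌋₊ : ℝ) + 1 := by push_cast; ring
    _ ≤ L / δ + 1 := by linarith [Nat.floor_le (div_nonneg hL hδ.le)]

/-- Integers in a residue class modulo `c ≠ 0` lying in `[-m, m]` number at most `2m/|c| + 1`.
[folklore] -/
theorem card_filter_modEq_le {c : ℤ} (hc : c ≠ 0) (m : ℤ) (hm : 0 ≤ m) (v : ℤ) (S : Finset ℤ)
    (hS : ∀ d ∈ S, -m ≤ d ∧ d ≤ m ∧ d ≡ v [ZMOD c]) :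
    (S.card : ℝ) ≤ 2 * m / |(c : ℝ)| + 1 := by
  have hc' : (0 : ℝ) < |(c : ℝ)| := abs_pos.2 (by exact_mod_cast hc)
  have key := card_le_of_spacing (S.image (fun d : ℤ => (d : ℝ))) hc' (by positivity : (0:ℝ) ≤ 2 * m)
    ?_ ?_
  · rwa [Finset.card_image_of_injective _ Int.cast_injective] at key
  · intro x hx y hy hxy
    rw [Finset.mem_image] at hx hy
    obtain ⟨d, hd, rfl⟩ := hx
    obtain ⟨d', hd', rfl⟩ := hy
    have hmod : d ≡ d' [ZMOD c] := (hS d hd).2.2.trans (hS d' hd').2.2.symm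
    obtain ⟨k, hk⟩ := Int.modEq_iff_dvd.1 hmod.symm
    have hk0 : k ≠ 0 := by
      rintro rfl
      apply hxy
      have : d = d' := by linarith
      rw [this]
    have h1 : (1 : ℝ) ≤ |(k : ℝ)| := by exact_mod_cast Int.one_le_abs hk0
    have : (d : ℝ) - d' = c * k := by exact_mod_cast hk
    rw [this, abs_mul]
    nlinarith
  · intro x hx y hy
    rw [Finset.mem_image] at hx hy
    obtain ⟨d, hd, rfl⟩ := hx
    obtain ⟨d', hd', rfl⟩ := hy
    have h1 := (hS d hd).2.1
    have h2 := (hS d' hd').1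
    have : (d : ℝ) ≤ m := by exact_mod_cast h1
    have : (-m : ℝ) ≤ d' := by exact_mod_cast h2
    linarith


/-! ### Mean value lower bounds -/

/-- `m (y - x) ≤ |f y - f x|` when `|f'| ≥ m` on `(x, y)`. [folklore] -/
theorem mvt_abs_lower {f f' : ℝ → ℝ} {x y m : ℝ} (hxy : x ≤ y) (hcont : ContinuousOn f (Icc x y))
    (hder : ∀ t ∈ Ioo x y, HasDerivAt f (f' t) t) (hm : ∀ t ∈ Ioo x y, m ≤ |f' t|) :
    m * (y - x) ≤ |f y - f x| := by
  rcases hxy.eq_or_lt with rfl | hlt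
  · simp
  obtain ⟨ξ, hξ, hξeq⟩ := exists_hasDerivAt_eq_slope f f' hlt hcont hder
  have hyx : 0 < y - x := sub_pos.2 hlt
  have : f y - f x = f' ξ * (y - x) := by rw [hξeq]; field_simp
  rw [this, abs_mul, abs_of_pos hyx]
  exact mul_le_mul_of_nonneg_right (hm ξ hξ) hyx.le

/-- The same on an order-connected set `I` carrying one-sided derivatives. [folklore] -/
theorem mvt_abs_lower_within {f f' : ℝ → ℝ} {I : Set ℝ} (hI : I.OrdConnected)
    (hf : ∀ t ∈ I, HasDerivWithinAt f (f' t) I t) {m : ℝ} (hm : ∀ t ∈ I, m ≤ |f' t|) {x y : ℝ}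
    (hx : x ∈ I) (hy : y ∈ I) : m * |y - x| ≤ |f y - f x| := by
  wlog hxy : x ≤ y generalizing x y
  · have := this hy hx (le_of_not_ge hxy)
    rwa [abs_sub_comm x y, abs_sub_comm (f x) (f y)] at this
  rw [abs_of_nonneg (sub_nonneg.2 hxy)]
  have hsub : Icc x y ⊆ I := hI.out hx hy
  refine mvt_abs_lower (f' := f') hxy ?_ ?_ ?_
  · exact fun t ht => (hf t (hsub ht)).continuousWithinAt.mono hsub
  · intro t ht
    exact (hf t (hsub (Ioo_subset_Icc_self ht))).hasDerivAt
      (Filter.mem_of_superset (Ioo_mem_nhds ht.1 ht.2) (Ioo_subset_Icc_self.trans hsub))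
  · exact fun t ht => hm t (hsub (Ioo_subset_Icc_self ht))

/-! ### The hypotheses on `h` -/

/-- The hypotheses of Graham–Kolesnik's Lemma 7.18 on the function `h` (those that the proof uses):
`I ⊆ [A/2C, 2A/C]` is an interval, `h` is differentiable on `I` with derivative `h'` (one-sided at
end points), and on `I`: `H/C₀ ≤ h`, `H/C₀ ≤ |x h'(x)| ≤ C₀ H`, `H/C₀ ≤ |h(x) - x h'(x)|`.
(The printed lemma also lists `h ≤ C₀ H` and `|h - x h'| ≤ C₀ H`; they are not needed.)
[cite: GrahamKolesnik1991, Lemma 7.18 (hypotheses)] -/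
structure IsSpacingFn (A C H C₀ : ℝ) (I : Set ℝ) (h h' : ℝ → ℝ) : Prop where
  ordConnected : I.OrdConnected
  subset_Icc : I ⊆ Set.Icc (A / (2 * C)) (2 * A / C)
  hasDerivWithinAt : ∀ x ∈ I, HasDerivWithinAt h (h' x) I x
  le_h : ∀ x ∈ I, H / C₀ ≤ h x
  abs_deriv_le : ∀ x ∈ I, |x * h' x| ≤ C₀ * H
  le_abs_deriv : ∀ x ∈ I, H / C₀ ≤ |x * h' x|
  le_abs_sub : ∀ x ∈ I, H / C₀ ≤ |h x - x * h' x|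

namespace IsSpacingFn

variable {A C H C₀ : ℝ} {I : Set ℝ} {h h' : ℝ → ℝ}

/-- Points of `I` are positive. [folklore] -/
theorem pos_of_mem (hh : IsSpacingFn A C H C₀ I h h') (hA : 0 < A) (hC : 0 < C) {x : ℝ}
    (hx : x ∈ I) : 0 < x :=
  lt_of_lt_of_le (by positivity) (hh.subset_Icc hx).1

/-- Points of `I` are `≤ 2A/C`. [folklore] -/
theorem le_of_mem (hh : IsSpacingFn A C H C₀ I h h') {x : ℝ} (hx : x ∈ I) : x ≤ 2 * A / C :=
  (hh.subset_Icc hx).2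

/-- Points of `I` are `≥ A/(2C)`. [folklore] -/
theorem ge_of_mem (hh : IsSpacingFn A C H C₀ I h h') {x : ℝ} (hx : x ∈ I) : A / (2 * C) ≤ x :=
  (hh.subset_Icc hx).1

/-- `|h'(x)| ≤ 2 C₀ H C / A` on `I`. [folklore] -/
theorem abs_deriv_le' (hh : IsSpacingFn A C H C₀ I h h') (hA : 0 < A) (hC : 0 < C)
    {x : ℝ} (hx : x ∈ I) : |h' x| ≤ 2 * C₀ * H * C / A := by
  have hx0 := hh.pos_of_mem hA hC hx
  have h1 := hh.abs_deriv_le x hx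
  rw [abs_mul, abs_of_pos hx0] at h1
  have h2 := hh.ge_of_mem hx
  rw [le_div_iff₀ hA]
  calc |h' x| * A = (x * |h' x|) * (A / x) := by field_simp
    _ ≤ (C₀ * H) * (2 * C) := by
        refine mul_le_mul h1 ?_ (by positivity) ((mul_nonneg hx0.le (abs_nonneg _)).trans h1)
        rw [div_le_iff₀ hx0]
        rw [div_le_iff₀ (by positivity)] at h2
        linarith
    _ = 2 * C₀ * H * C := by ring

/-- `|h'(x)| ≥ H C / (2 C₀ A)` on `I`. [folklore] -/
theorem le_abs_deriv' (hh : IsSpacingFn A C H C₀ I h h') (hA : 0 < A) (hC : 0 < C) (hC₀ : 0 < C₀)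
    {x : ℝ} (hx : x ∈ I) : H * C / (2 * C₀ * A) ≤ |h' x| := by
  have hx0 := hh.pos_of_mem hA hC hx
  have h1 := hh.le_abs_deriv x hx
  rw [abs_mul, abs_of_pos hx0] at h1
  have h2 := hh.le_of_mem hx
  rw [div_le_iff₀ (by positivity)]
  rw [div_le_iff₀ hC₀] at h1
  rw [le_div_iff₀ hC] at h2
  calc H * C ≤ (x * |h' x| * C₀) * C := by nlinarith
    _ = |h' x| * (C₀ * (x * C)) := by ring
    _ ≤ |h' x| * (C₀ * (2 * A)) := by gcongr
    _ = |h' x| * (2 * C₀ * A) := by ring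

/-- `(H C / (2 C₀ A)) |y - x| ≤ |h(y) - h(x)|` for `x, y ∈ I` (used in the case `c = 0`).
[cite: GrahamKolesnik1991, Lemma 7.18, proof, case c = 0] -/
theorem h_sub_h (hh : IsSpacingFn A C H C₀ I h h') (hA : 0 < A) (hC : 0 < C) (hC₀ : 0 < C₀)
    {x y : ℝ} (hx : x ∈ I) (hy : y ∈ I) :
    H * C / (2 * C₀ * A) * |y - x| ≤ |h y - h x| :=
  mvt_abs_lower_within hh.ordConnected hh.hasDerivWithinAt
    (fun _ ht => hh.le_abs_deriv' hA hC hC₀ ht) hx hy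

/-- `(H C² / (4 C₀ A²)) |y - x| ≤ |h(y)/y - h(x)/x|` for `x, y ∈ I` (the function `h(u)/u` has
derivative `(u h' - h)/u²`; used in the case `b = 0`).
[cite: GrahamKolesnik1991, Lemma 7.18, proof, case b = 0] -/
theorem k_sub_k (hh : IsSpacingFn A C H C₀ I h h') (hA : 0 < A) (hC : 0 < C) (hC₀ : 0 < C₀)
    (hH : 0 ≤ H) {x y : ℝ} (hx : x ∈ I) (hy : y ∈ I) :
    H * C ^ 2 / (4 * C₀ * A ^ 2) * |y - x| ≤ |h y / y - h x / x| := by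
  have hder : ∀ t ∈ I, HasDerivWithinAt (fun u => h u / u) ((h' t * t - h t * 1) / t ^ 2) I t :=
    fun t ht => (hh.hasDerivWithinAt t ht).div (hasDerivWithinAt_id t I) (hh.pos_of_mem hA hC ht).ne'
  refine mvt_abs_lower_within hh.ordConnected hder (fun t ht => ?_) hx hy
  have ht0 := hh.pos_of_mem hA hC ht
  have h1 := hh.le_abs_sub t ht
  have h2 := hh.le_of_mem ht
  rw [abs_div, abs_of_pos (by positivity : (0:ℝ) < t ^ 2), le_div_iff₀ (by positivity)]
  have h3 : |h' t * t - h t * 1| = |h t - t * h' t| := by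
    rw [abs_sub_comm]; ring_nf
  rw [h3]
  rw [div_le_iff₀ hC₀] at h1
  rw [le_div_iff₀ hC] at h2
  have h4 : t ^ 2 * C ^ 2 ≤ (2 * A) ^ 2 := by
    rw [← mul_pow]; exact pow_le_pow_left₀ (by positivity) h2 2
  calc H * C ^ 2 / (4 * C₀ * A ^ 2) * t ^ 2 = H * (t ^ 2 * C ^ 2) / (C₀ * (2 * A) ^ 2) := by ring
    _ ≤ H * (2 * A) ^ 2 / (C₀ * (2 * A) ^ 2) := by gcongr
    _ = H / C₀ := by field_simp
    _ ≤ |h t - t * h' t| := by rw [div_le_iff₀ hC₀]; exact h1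

end IsSpacingFn

/-! ### The conditions (7.5.2), (7.5.3) and the count `B` -/

/-- Condition (7.5.2): `‖ r̄/q - r̄₁/q₁ ‖ ≤ Δ₁` where `r r̄ ≡ 1 (mod q)`, `r₁ r̄₁ ≡ 1 (mod q₁)` and `‖·‖`
is the distance to the nearest integer — equivalently, there are inverses `u` of `r (mod q)` and `u₁`
of `r₁ (mod q₁)` with `|u/q - u₁/q₁| ≤ Δ₁`. [cite: GrahamKolesnik1991, Lemma 7.18, (7.5.2)] -/
def InvClose (Δ₁ : ℝ) (p p₁ : ℤ × ℤ) : Prop :=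
  ∃ u u₁ : ℤ, p.1 * u ≡ 1 [ZMOD p.2] ∧ p₁.1 * u₁ ≡ 1 [ZMOD p₁.2] ∧
    |(u : ℝ) / p.2 - u₁ / p₁.2| ≤ Δ₁

/-- Condition (7.5.3): `|q h(r/q) - q₁ h(r₁/q₁)| ≤ C H Δ₂`. [cite: GrahamKolesnik1991, Lemma 7.18, (7.5.3)] -/
def HClose (C H Δ₂ : ℝ) (h : ℝ → ℝ) (p p₁ : ℤ × ℤ) : Prop :=
  |(p.2 : ℝ) * h (p.1 / p.2) - p₁.2 * h (p₁.1 / p₁.2)| ≤ C * H * Δ₂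

/-- The pairs counted by `B` in Graham–Kolesnik's Lemma 7.18: ordered pairs of points of `𝓟(A, C, I)`
satisfying (7.5.2) and (7.5.3). [cite: GrahamKolesnik1991, Lemma 7.18] -/
def goodPairs (A C Δ₁ Δ₂ H : ℝ) (I : Set ℝ) (h : ℝ → ℝ) : Finset ((ℤ × ℤ) × (ℤ × ℤ)) :=
  open Classical in
  ((points A C I) ×ˢ (points A C I)).filter fun pp => InvClose Δ₁ pp.1 pp.2 ∧ HClose C H Δ₂ h pp.1 pp.2

/-- `B = B(A, C, Δ₁, Δ₂; h, H, I)`, the number of solutions of (7.5.2)–(7.5.4).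
[cite: GrahamKolesnik1991, Lemma 7.18] -/
def pairCount (A C Δ₁ Δ₂ H : ℝ) (I : Set ℝ) (h : ℝ → ℝ) : ℕ := (goodPairs A C Δ₁ Δ₂ H I h).card

/-- Membership in `goodPairs`. [folklore] -/
theorem mem_goodPairs {A C Δ₁ Δ₂ H : ℝ} {I : Set ℝ} {h : ℝ → ℝ} {pp : (ℤ × ℤ) × (ℤ × ℤ)} :
    pp ∈ goodPairs A C Δ₁ Δ₂ H I h ↔ pp.1 ∈ points A C I ∧ pp.2 ∈ points A C I ∧
      InvClose Δ₁ pp.1 pp.2 ∧ HClose C H Δ₂ h pp.1 pp.2 := by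
  classical
  simp only [goodPairs, Finset.mem_filter, Finset.mem_product, and_assoc]

/-! ### The transition matrix of a pair -/

/-- Lemma 7.17 for a pair satisfying (7.5.2): a unimodular `γ` with `γ p = p₁` and `|c| ≤ Δ₁ q q₁`.
[cite: GrahamKolesnik1991, Lemma 7.17] -/
theorem exists_tmat_of_invClose {Δ₁ : ℝ} {p p₁ : ℤ × ℤ} (hq : 0 < p.2) (hq₁ : 0 < p₁.2)
    (hinv : InvClose Δ₁ p p₁) :
    ∃ γ : TMat, γ.det = 1 ∧ γ.apply p = p₁ ∧ |(γ.c : ℝ)| ≤ Δ₁ * p.2 * p₁.2 := by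
  obtain ⟨u, u₁, hu, hu₁, hΔ⟩ := hinv
  obtain ⟨γ, hdet, happ, hc⟩ := exists_transitionMatrix hu hu₁
  refine ⟨γ, hdet, happ, ?_⟩
  have hq' : (0 : ℝ) < p.2 := by exact_mod_cast hq
  have hq₁' : (0 : ℝ) < p₁.2 := by exact_mod_cast hq₁
  have : (γ.c : ℝ) = p.2 * p₁.2 * (u / p.2 - u₁ / p₁.2) := by
    rw [hc]; push_cast; field_simp
  rw [this, abs_mul, abs_of_pos (mul_pos hq' hq₁')]
  calc (p.2 : ℝ) * p₁.2 * |(u : ℝ) / p.2 - u₁ / p₁.2| ≤ p.2 * p₁.2 * Δ₁ := by gcongr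
    _ = Δ₁ * p.2 * p₁.2 := by ring

/-- A transition matrix `γ(p, p₁)` for a pair satisfying (7.5.2) (Lemma 7.17), chosen once and for
all; the identity matrix if the hypotheses fail. [cite: GrahamKolesnik1991, Lemma 7.18, proof, (7.5.5)] -/
def mat (Δ₁ : ℝ) (pp : (ℤ × ℤ) × (ℤ × ℤ)) : TMat :=
  open Classical in
  if hc : 0 < pp.1.2 ∧ 0 < pp.2.2 ∧ InvClose Δ₁ pp.1 pp.2 then
    Classical.choose (exists_tmat_of_invClose hc.1 hc.2.1 hc.2.2)
  else ⟨1, 0, 0, 1⟩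

/-- The defining properties of `mat`. [cite: GrahamKolesnik1991, Lemma 7.17] -/
theorem mat_spec {Δ₁ : ℝ} {pp : (ℤ × ℤ) × (ℤ × ℤ)}
    (hc : 0 < pp.1.2 ∧ 0 < pp.2.2 ∧ InvClose Δ₁ pp.1 pp.2) :
    (mat Δ₁ pp).det = 1 ∧ (mat Δ₁ pp).apply pp.1 = pp.2 ∧
      |((mat Δ₁ pp).c : ℝ)| ≤ Δ₁ * pp.1.2 * pp.2.2 := by
  classical
  unfold mat
  rw [dif_pos hc]
  exact Classical.choose_spec (exists_tmat_of_invClose hc.1 hc.2.1 hc.2.2)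

/-! ### Facts about a good pair and its matrix -/

section PairFacts

variable {A C Δ₁ Δ₂ H C₀ : ℝ} {I : Set ℝ} {h h' : ℝ → ℝ} {pp : (ℤ × ℤ) × (ℤ × ℤ)}

/-- Unpacking a good pair: sizes, membership in `I`, the matrix relations (7.5.5) and `|c| ≤ Δ₁ q q₁`.
[cite: GrahamKolesnik1991, Lemma 7.18, proof, (7.5.5)] -/
theorem goodPair_facts (hC : 0 < C) (hpp : pp ∈ goodPairs A C Δ₁ Δ₂ H I h) :
    (A < pp.1.1 ∧ (pp.1.1 : ℝ) ≤ 2 * A) ∧ (C < pp.1.2 ∧ (pp.1.2 : ℝ) ≤ 2 * C) ∧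
    (A < pp.2.1 ∧ (pp.2.1 : ℝ) ≤ 2 * A) ∧ (C < pp.2.2 ∧ (pp.2.2 : ℝ) ≤ 2 * C) ∧
    (pp.1.1 : ℝ) / pp.1.2 ∈ I ∧ (pp.2.1 : ℝ) / pp.2.2 ∈ I ∧
    (mat Δ₁ pp).det = 1 ∧ (mat Δ₁ pp).apply pp.1 = pp.2 ∧
    |((mat Δ₁ pp).c : ℝ)| ≤ Δ₁ * pp.1.2 * pp.2.2 ∧ HClose C H Δ₂ h pp.1 pp.2 := by
  rw [mem_goodPairs] at hpp
  obtain ⟨h1, h2, hinv, hcl⟩ := hpp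
  rw [mem_points] at h1 h2
  have hq : 0 < pp.1.2 := by exact_mod_cast hC.trans h1.2.1.1
  have hq₁ : 0 < pp.2.2 := by exact_mod_cast hC.trans h2.2.1.1
  obtain ⟨hdet, happ, hc⟩ := mat_spec ⟨hq, hq₁, hinv⟩
  exact ⟨h1.1, h1.2.1, h2.1, h2.2.1, h1.2.2.2, h2.2.2.2, hdet, happ, hc, hcl⟩

end PairFacts


section Cases

variable {A C Δ₁ Δ₂ H C₀ : ℝ} {I : Set ℝ} {h h' : ℝ → ℝ} {pp : (ℤ × ℤ) × (ℤ × ℤ)}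

/-- **Case `c = 0`** (proof of Lemma 7.18): then `a = d = 1`, `q₁ = q`, `r₁ = r + b q` and
`|b| ≤ 2 C₀ A Δ₂ / C`. [cite: GrahamKolesnik1991, Lemma 7.18, proof, case c = 0] -/
theorem caseC (hh : IsSpacingFn A C H C₀ I h h') (hA : 0 < A) (hC : 0 < C) (hC₀ : 0 < C₀)
    (hH : 0 < H) (hpp : pp ∈ goodPairs A C Δ₁ Δ₂ H I h) (hc : (mat Δ₁ pp).c = 0) :
    (mat Δ₁ pp).a = 1 ∧ (mat Δ₁ pp).d = 1 ∧ |((mat Δ₁ pp).b : ℝ)| ≤ 2 * C₀ * A * Δ₂ / C := by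
  obtain ⟨⟨hr1, -⟩, ⟨hq1, -⟩, ⟨hr1', -⟩, ⟨hq1', -⟩, hxI, hx₁I, hdet, happ, -, hcl⟩ :=
    goodPair_facts hC hpp
  set γ := mat Δ₁ pp with hγ
  simp only [TMat.apply, Prod.ext_iff] at happ
  obtain ⟨h₁, h₂⟩ := happ
  rw [hc, zero_mul, zero_add] at h₂
  unfold TMat.det at hdet
  rw [hc, mul_zero, sub_zero] at hdet
  have hq : (0 : ℝ) < pp.1.2 := hC.trans hq1
  have hq' : (0 : ℝ) < pp.2.2 := hC.trans hq1'
  have hd : γ.d = 1 := by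
    rcases Int.eq_one_or_neg_one_of_mul_eq_one' hdet with ⟨-, h⟩ | ⟨-, h⟩
    · exact h
    · exfalso
      rw [h] at h₂
      have : ((-1 * pp.1.2 : ℤ) : ℝ) = pp.2.2 := by exact_mod_cast h₂
      push_cast at this
      linarith
  have ha : γ.a = 1 := by rw [hd, mul_one] at hdet; exact hdet
  refine ⟨ha, hd, ?_⟩
  rw [hd, one_mul] at h₂
  rw [ha, one_mul] at h₁
  unfold HClose at hcl
  set x : ℝ := (pp.1.1 : ℝ) / pp.1.2 with hx
  set x₁ : ℝ := (pp.2.1 : ℝ) / pp.2.2 with hx₁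
  -- `x₁ - x = b`
  have hx1 : x₁ - x = γ.b := by
    have e1 : (pp.2.1 : ℝ) = pp.1.1 + γ.b * pp.1.2 := by exact_mod_cast h₁.symm
    have e2 : (pp.2.2 : ℝ) = pp.1.2 := by exact_mod_cast h₂.symm
    rw [hx, hx₁, e1, e2]; field_simp; ring
  have hmvt := hh.h_sub_h hA hC hC₀ hxI hx₁I
  rw [hx1] at hmvt
  have hcl' : (pp.1.2 : ℝ) * |h x₁ - h x| ≤ C * H * Δ₂ := by
    have e2 : (pp.2.2 : ℝ) = pp.1.2 := by exact_mod_cast h₂.symm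
    rw [e2, ← mul_sub, abs_mul, abs_of_pos hq, abs_sub_comm] at hcl
    exact hcl
  have key : C * (H * C / (2 * C₀ * A) * |(γ.b : ℝ)|) ≤ C * H * Δ₂ :=
    calc C * (H * C / (2 * C₀ * A) * |(γ.b : ℝ)|)
        ≤ pp.1.2 * |h x₁ - h x| := mul_le_mul hq1.le hmvt (by positivity) hq.le
      _ ≤ C * H * Δ₂ := hcl'
  have key' : (H * C) * (|(γ.b : ℝ)| * C) ≤ (H * C) * (2 * C₀ * A * Δ₂) := by
    have e : C * (H * C / (2 * C₀ * A) * |(γ.b : ℝ)|) =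
        (H * C) * (|(γ.b : ℝ)| * C) / (2 * C₀ * A) := by ring
    rw [e, div_le_iff₀ (by positivity)] at key
    calc (H * C) * (|(γ.b : ℝ)| * C) ≤ C * H * Δ₂ * (2 * C₀ * A) := key
      _ = (H * C) * (2 * C₀ * A * Δ₂) := by ring
  rw [le_div_iff₀ hC]
  exact le_of_mul_le_mul_left key' (by positivity)

/-- **Case `b = 0`**: then `a = d = 1`, `r₁ = r`, `q₁ = c r + q` and `|c| ≤ 16 C₀ C Δ₂ / A`.
[cite: GrahamKolesnik1991, Lemma 7.18, proof, case b = 0] -/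
theorem caseB (hh : IsSpacingFn A C H C₀ I h h') (hA : 0 < A) (hC : 0 < C) (hC₀ : 0 < C₀)
    (hH : 0 < H) (hpp : pp ∈ goodPairs A C Δ₁ Δ₂ H I h) (hb : (mat Δ₁ pp).b = 0) :
    (mat Δ₁ pp).a = 1 ∧ (mat Δ₁ pp).d = 1 ∧ |((mat Δ₁ pp).c : ℝ)| ≤ 16 * C₀ * C * Δ₂ / A := by
  obtain ⟨⟨hr1, -⟩, ⟨hq1, hq2⟩, ⟨hr1', -⟩, ⟨hq1', hq2'⟩, hxI, hx₁I, hdet, happ, -, hcl⟩ :=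
    goodPair_facts hC hpp
  set γ := mat Δ₁ pp with hγ
  simp only [TMat.apply, Prod.ext_iff] at happ
  obtain ⟨h₁, h₂⟩ := happ
  rw [hb, zero_mul, add_zero] at h₁
  unfold TMat.det at hdet
  rw [hb, zero_mul, sub_zero] at hdet
  have hr : (0 : ℝ) < pp.1.1 := hA.trans hr1
  have hr' : (0 : ℝ) < pp.2.1 := hA.trans hr1'
  have hq : (0 : ℝ) < pp.1.2 := hC.trans hq1
  have hq' : (0 : ℝ) < pp.2.2 := hC.trans hq1'
  have ha : γ.a = 1 := by
    rcases Int.eq_one_or_neg_one_of_mul_eq_one' hdet with ⟨h, -⟩ | ⟨h, -⟩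
    · exact h
    · exfalso
      rw [h] at h₁
      have : ((-1 * pp.1.1 : ℤ) : ℝ) = pp.2.1 := by exact_mod_cast h₁
      push_cast at this
      linarith
  have hd : γ.d = 1 := by rw [ha, one_mul] at hdet; exact hdet
  refine ⟨ha, hd, ?_⟩
  rw [ha, one_mul] at h₁
  rw [hd, one_mul] at h₂
  -- reals
  have e1 : (pp.2.1 : ℝ) = pp.1.1 := by exact_mod_cast h₁.symm
  have e2 : (pp.2.2 : ℝ) = γ.c * pp.1.1 + pp.1.2 := by exact_mod_cast h₂.symm
  set x : ℝ := (pp.1.1 : ℝ) / pp.1.2 with hx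
  set x₁ : ℝ := (pp.2.1 : ℝ) / pp.2.2 with hx₁
  have hx0 : 0 < x := div_pos hr hq
  have hx₁0 : 0 < x₁ := div_pos hr' hq'
  -- `q h x - q₁ h x₁ = r (h x / x - h x₁ / x₁)`
  have hfac : (pp.1.2 : ℝ) * h x - pp.2.2 * h x₁ = pp.1.1 * (h x / x - h x₁ / x₁) := by
    rw [hx, hx₁, e1]; field_simp
  have hmvt := hh.k_sub_k hA hC hC₀ hH.le hx₁I hxI
  -- `|x - x₁| = r² |c| / (q q₁)`
  have hdiff : |x - x₁| = (pp.1.1 : ℝ) ^ 2 * |(γ.c : ℝ)| / (pp.1.2 * pp.2.2) := by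
    have : x - x₁ = (pp.1.1 : ℝ) ^ 2 * γ.c / (pp.1.2 * pp.2.2) := by
      rw [hx, hx₁, e1, div_sub_div _ _ hq.ne' hq'.ne', e2]; ring
    rw [this, abs_div, abs_mul, abs_of_pos (mul_pos hq hq'), abs_of_pos (by positivity)]
  rw [hdiff] at hmvt
  unfold HClose at hcl
  rw [hfac, abs_mul, abs_of_pos hr] at hcl
  -- chain
  have hqq : (pp.1.2 : ℝ) * pp.2.2 ≤ 4 * C ^ 2 := by nlinarith
  have hrr : A ^ 2 ≤ (pp.1.1 : ℝ) ^ 2 := by nlinarith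
  have key : A * (H * C ^ 2 / (4 * C₀ * A ^ 2) * (A ^ 2 * |(γ.c : ℝ)| / (4 * C ^ 2))) ≤ C * H * Δ₂ :=
    calc A * (H * C ^ 2 / (4 * C₀ * A ^ 2) * (A ^ 2 * |(γ.c : ℝ)| / (4 * C ^ 2)))
        ≤ pp.1.1 * (H * C ^ 2 / (4 * C₀ * A ^ 2) *
            ((pp.1.1 : ℝ) ^ 2 * |(γ.c : ℝ)| / (pp.1.2 * pp.2.2))) := by
          refine mul_le_mul hr1.le ?_ (by positivity) hr.le
          refine mul_le_mul_of_nonneg_left ?_ (by positivity)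
          rw [div_le_div_iff₀ (by positivity) (by positivity)]
          calc A ^ 2 * |(γ.c : ℝ)| * (pp.1.2 * pp.2.2) ≤ A ^ 2 * |(γ.c : ℝ)| * (4 * C ^ 2) := by
                gcongr
            _ ≤ (pp.1.1 : ℝ) ^ 2 * |(γ.c : ℝ)| * (4 * C ^ 2) := by gcongr
      _ ≤ pp.1.1 * |h x / x - h x₁ / x₁| := mul_le_mul_of_nonneg_left hmvt hr.le
      _ ≤ C * H * Δ₂ := hcl
  have key' : (H * A ^ 2 * C ^ 2) * (|(γ.c : ℝ)| * A) ≤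
      (H * A ^ 2 * C ^ 2) * (16 * C₀ * C * Δ₂) := by
    have e : A * (H * C ^ 2 / (4 * C₀ * A ^ 2) * (A ^ 2 * |(γ.c : ℝ)| / (4 * C ^ 2))) =
        (H * A ^ 2 * C ^ 2) * (|(γ.c : ℝ)| * A) / (16 * C₀ * A ^ 2 * C ^ 2) := by ring
    rw [e, div_le_iff₀ (by positivity)] at key
    calc (H * A ^ 2 * C ^ 2) * (|(γ.c : ℝ)| * A) ≤ C * H * Δ₂ * (16 * C₀ * A ^ 2 * C ^ 2) := key
      _ = (H * A ^ 2 * C ^ 2) * (16 * C₀ * C * Δ₂) := by ring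
  rw [le_div_iff₀ hA]
  exact le_of_mul_le_mul_left key' (by positivity)

/-- **Case `a = 0`**: then `b = 1`, `c = -1` and `1 ≤ d ≤ 3`.
[cite: GrahamKolesnik1991, Lemma 7.18, proof, case a = 0] -/
theorem caseA (hA : 0 < A) (hC : 0 < C) (hpp : pp ∈ goodPairs A C Δ₁ Δ₂ H I h)
    (ha : (mat Δ₁ pp).a = 0) :
    (mat Δ₁ pp).b = 1 ∧ (mat Δ₁ pp).c = -1 ∧ 1 ≤ (mat Δ₁ pp).d ∧ (mat Δ₁ pp).d ≤ 3 := by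
  obtain ⟨⟨hr1, hr2⟩, ⟨hq1, hq2⟩, ⟨hr1', hr2'⟩, ⟨hq1', hq2'⟩, -, -, hdet, happ, -, -⟩ :=
    goodPair_facts hC hpp
  set γ := mat Δ₁ pp with hγ
  simp only [TMat.apply, Prod.ext_iff] at happ
  obtain ⟨h₁, h₂⟩ := happ
  rw [ha, zero_mul, zero_add] at h₁
  unfold TMat.det at hdet
  rw [ha, zero_mul, zero_sub, neg_eq_iff_eq_neg] at hdet
  have hq : (0 : ℝ) < pp.1.2 := hC.trans hq1
  have hr' : (0 : ℝ) < pp.2.1 := hA.trans hr1'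
  have hb : γ.b = 1 := by
    rcases Int.eq_one_or_neg_one_of_mul_eq_neg_one' hdet with ⟨h, -⟩ | ⟨h, -⟩
    · exact h
    · exfalso
      rw [h] at h₁
      have : ((-1 * pp.1.2 : ℤ) : ℝ) = pp.2.1 := by exact_mod_cast h₁
      push_cast at this
      linarith
  have hc : γ.c = -1 := by
    rcases Int.eq_one_or_neg_one_of_mul_eq_neg_one' hdet with ⟨-, h⟩ | ⟨h, -⟩
    · exact h
    · rw [hb] at h; norm_num at h
  refine ⟨hb, hc, ?_, ?_⟩
  · -- `d q = q₁ + r > 0`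
    rw [hc] at h₂
    have e : ((γ.d * pp.1.2 : ℤ) : ℝ) = pp.2.2 + pp.1.1 := by
      have : γ.d * pp.1.2 = pp.2.2 + pp.1.1 := by linarith
      exact_mod_cast this
    push_cast at e
    have hpos : (0 : ℝ) < γ.d * pp.1.2 := by rw [e]; linarith [hA.trans hr1, hC.trans hq1']
    have : (0 : ℝ) < γ.d := pos_of_mul_pos_left hpos hq.le
    exact_mod_cast this
  · rw [hc] at h₂
    rw [hb, one_mul] at h₁
    have e : ((γ.d * pp.1.2 : ℤ) : ℝ) = pp.2.2 + pp.1.1 := by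
      have : γ.d * pp.1.2 = pp.2.2 + pp.1.1 := by linarith
      exact_mod_cast this
    push_cast at e
    have e1 : (pp.1.2 : ℝ) = pp.2.1 := by exact_mod_cast h₁
    -- `q = r₁ > A`, `q > C`; `q₁ ≤ 2C < 2q`, `r ≤ 2A < 2q`
    have hlt : (γ.d : ℝ) * pp.1.2 < 4 * pp.1.2 := by rw [e]; linarith
    have : (γ.d : ℝ) < 4 := lt_of_mul_lt_mul_right hlt hq.le
    have : γ.d < 4 := by exact_mod_cast this
    omega

/-- **Case `d = 0`**: then `c = 1`, `b = -1` and `1 ≤ a ≤ 3`.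
[cite: GrahamKolesnik1991, Lemma 7.18, proof, case d = 0] -/
theorem caseD (hA : 0 < A) (hC : 0 < C) (hpp : pp ∈ goodPairs A C Δ₁ Δ₂ H I h)
    (hd : (mat Δ₁ pp).d = 0) :
    (mat Δ₁ pp).c = 1 ∧ (mat Δ₁ pp).b = -1 ∧ 1 ≤ (mat Δ₁ pp).a ∧ (mat Δ₁ pp).a ≤ 3 := by
  obtain ⟨⟨hr1, hr2⟩, ⟨hq1, hq2⟩, ⟨hr1', hr2'⟩, ⟨hq1', hq2'⟩, -, -, hdet, happ, -, -⟩ :=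
    goodPair_facts hC hpp
  set γ := mat Δ₁ pp with hγ
  simp only [TMat.apply, Prod.ext_iff] at happ
  obtain ⟨h₁, h₂⟩ := happ
  rw [hd, zero_mul, add_zero] at h₂
  unfold TMat.det at hdet
  rw [hd, mul_zero, zero_sub, neg_eq_iff_eq_neg] at hdet
  have hr : (0 : ℝ) < pp.1.1 := hA.trans hr1
  have hq' : (0 : ℝ) < pp.2.2 := hC.trans hq1'
  have hc : γ.c = 1 := by
    rcases Int.eq_one_or_neg_one_of_mul_eq_neg_one' hdet with ⟨-, h⟩ | ⟨-, h⟩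
    · exfalso
      rw [h] at h₂
      have : ((-1 * pp.1.1 : ℤ) : ℝ) = pp.2.2 := by exact_mod_cast h₂
      push_cast at this
      linarith
    · exact h
  have hb : γ.b = -1 := by
    rcases Int.eq_one_or_neg_one_of_mul_eq_neg_one' hdet with ⟨-, h⟩ | ⟨h, -⟩
    · rw [hc] at h; norm_num at h
    · exact h
  refine ⟨hc, hb, ?_, ?_⟩
  · rw [hb] at h₁
    have e : ((γ.a * pp.1.1 : ℤ) : ℝ) = pp.2.1 + pp.1.2 := by
      have : γ.a * pp.1.1 = pp.2.1 + pp.1.2 := by linarith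
      exact_mod_cast this
    push_cast at e
    have hpos : (0 : ℝ) < γ.a * pp.1.1 := by rw [e]; linarith [hA.trans hr1', hC.trans hq1]
    have : (0 : ℝ) < γ.a := pos_of_mul_pos_left hpos hr.le
    exact_mod_cast this
  · rw [hb] at h₁
    rw [hc, one_mul] at h₂
    have e : ((γ.a * pp.1.1 : ℤ) : ℝ) = pp.2.1 + pp.1.2 := by
      have : γ.a * pp.1.1 = pp.2.1 + pp.1.2 := by linarith
      exact_mod_cast this
    push_cast at e
    have e1 : (pp.1.1 : ℝ) = pp.2.2 := by exact_mod_cast h₂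
    have hlt : (γ.a : ℝ) * pp.1.1 < 4 * pp.1.1 := by rw [e]; linarith
    have : (γ.a : ℝ) < 4 := lt_of_mul_lt_mul_right hlt hr.le
    have : γ.a < 4 := by exact_mod_cast this
    omega

/-- **Case `abcd ≠ 0`, `|bc| < D`**: all entries are bounded by `D` in modulus. [folklore] -/
theorem caseSmall (γ : TMat) (hγ : γ.det = 1) (ha : γ.a ≠ 0) (hb : γ.b ≠ 0) (hc : γ.c ≠ 0)
    (hd : γ.d ≠ 0) {D : ℤ} (hD : |γ.b * γ.c| < D) :
    |γ.a| ≤ D ∧ |γ.b| ≤ D ∧ |γ.c| ≤ D ∧ |γ.d| ≤ D := by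
  unfold TMat.det at hγ
  have hbc : |γ.b * γ.c| + 1 ≤ D := hD
  have ha1 : 1 ≤ |γ.a| := Int.one_le_abs ha
  have hb1 : 1 ≤ |γ.b| := Int.one_le_abs hb
  have hc1 : 1 ≤ |γ.c| := Int.one_le_abs hc
  have hd1 : 1 ≤ |γ.d| := Int.one_le_abs hd
  rw [abs_mul] at hbc
  have had : |γ.a| * |γ.d| ≤ D := by
    rw [← abs_mul, show γ.a * γ.d = 1 + γ.b * γ.c by linarith]
    calc |1 + γ.b * γ.c| ≤ |(1 : ℤ)| + |γ.b * γ.c| := abs_add_le _ _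
      _ = |γ.b| * |γ.c| + 1 := by rw [abs_one, abs_mul]; ring
      _ ≤ D := hbc
  refine ⟨?_, ?_, ?_, ?_⟩ <;> nlinarith

/-- **Case `|bc| ≥ D = 4W² + 4W`** (`W ≥ 1`): then `w = |c| A / C ≥ W` (Graham–Kolesnik (7.5.6)),
`|a| ≤ 4 |c| A / C` and `|d| ≤ 4 |c| A / C` ((7.5.8)–(7.5.9), upper halves).
[cite: GrahamKolesnik1991, Lemma 7.18, proof, (7.5.6)–(7.5.9)] -/
theorem caseBig (hh : IsSpacingFn A C H C₀ I h h') (hA : 0 < A) (hC : 0 < C)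
    (hpp : pp ∈ goodPairs A C Δ₁ Δ₂ H I h) {W : ℝ} (hW : 1 ≤ W)
    (hbig : 4 * W ^ 2 + 4 * W ≤ |((mat Δ₁ pp).b : ℝ) * (mat Δ₁ pp).c|) :
    W * C ≤ |((mat Δ₁ pp).c : ℝ)| * A ∧ |((mat Δ₁ pp).a : ℝ)| ≤ 4 * |((mat Δ₁ pp).c : ℝ)| * A / C ∧
      |((mat Δ₁ pp).d : ℝ)| ≤ 4 * |((mat Δ₁ pp).c : ℝ)| * A / C := by
  obtain ⟨⟨hr1, hr2⟩, ⟨hq1, hq2⟩, ⟨hr1', hr2'⟩, ⟨hq1', hq2'⟩, hxI, hx₁I, hdet, happ, -, -⟩ :=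
    goodPair_facts hC hpp
  set γ := mat Δ₁ pp with hγ
  obtain ⟨e3, e4, e5⟩ := transitionMatrix_entries γ hdet happ
  have hr : (0 : ℝ) < pp.1.1 := hA.trans hr1
  have hr' : (0 : ℝ) < pp.2.1 := hA.trans hr1'
  have hq : (0 : ℝ) < pp.1.2 := hC.trans hq1
  have hq' : (0 : ℝ) < pp.2.2 := hC.trans hq1'
  have hxle : (pp.1.1 : ℝ) / pp.1.2 ≤ 2 * A / C := hh.le_of_mem hxI
  have hx₁le : (pp.2.1 : ℝ) / pp.2.2 ≤ 2 * A / C := hh.le_of_mem hx₁I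
  set w : ℝ := |(γ.c : ℝ)| * A / C with hw
  have hw0 : 0 ≤ w := by positivity
  -- `|b| ≤ |c| x x₁ + r₁/q + r/q₁ ≤ 4 |c| A²/C² + 4A/C`
  have hb : |(γ.b : ℝ)| ≤ 4 * |(γ.c : ℝ)| * A ^ 2 / C ^ 2 + 4 * A / C := by
    have e5' : (γ.b : ℝ) * (pp.1.2 * pp.2.2) = -γ.c * pp.1.1 * pp.2.1 + pp.2.1 * pp.2.2
        - pp.1.1 * pp.1.2 := by
      have e : ((γ.b * pp.1.2 * pp.2.2 : ℤ) : ℝ) =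
          ((-γ.c * pp.1.1 * pp.2.1 + pp.2.1 * pp.2.2 - pp.1.1 * pp.1.2 : ℤ) : ℝ) := by rw [e5]
      push_cast at e
      linarith
    have hbq : |(γ.b : ℝ)| * (pp.1.2 * pp.2.2) ≤ |(γ.c : ℝ)| * pp.1.1 * pp.2.1
        + pp.2.1 * pp.2.2 + pp.1.1 * pp.1.2 := by
      have := congrArg abs e5'
      rw [abs_mul, abs_of_pos (mul_pos hq hq')] at this
      rw [this]
      calc |-(γ.c : ℝ) * pp.1.1 * pp.2.1 + pp.2.1 * pp.2.2 - pp.1.1 * pp.1.2|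
          ≤ |-(γ.c : ℝ) * pp.1.1 * pp.2.1 + pp.2.1 * pp.2.2| + |(pp.1.1 : ℝ) * pp.1.2| :=
            abs_sub _ _
        _ ≤ |-(γ.c : ℝ) * pp.1.1 * pp.2.1| + |(pp.2.1 : ℝ) * pp.2.2| + |(pp.1.1 : ℝ) * pp.1.2| := by
            gcongr; exact abs_add_le _ _
        _ = |(γ.c : ℝ)| * pp.1.1 * pp.2.1 + pp.2.1 * pp.2.2 + pp.1.1 * pp.1.2 := by
            rw [abs_mul, abs_mul, abs_neg, abs_of_pos hr, abs_of_pos hr', abs_of_pos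
              (mul_pos hr' hq'), abs_of_pos (mul_pos hr hq)]
    -- divide by `q q₁` and use the size constraints
    rw [div_le_iff₀ hq] at hxle   -- r ≤ 2A/C * q
    rw [div_le_iff₀ hq'] at hx₁le
    have h1 : |(γ.c : ℝ)| * pp.1.1 * pp.2.1 ≤ |(γ.c : ℝ)| * (2 * A / C * pp.1.2) * (2 * A / C * pp.2.2) := by
      have := abs_nonneg (γ.c : ℝ)
      calc |(γ.c : ℝ)| * pp.1.1 * pp.2.1 = |(γ.c : ℝ)| * (pp.1.1 * pp.2.1) := by ring
        _ ≤ |(γ.c : ℝ)| * ((2 * A / C * pp.1.2) * (2 * A / C * pp.2.2)) :=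
            mul_le_mul_of_nonneg_left (mul_le_mul hxle hx₁le hr'.le (by positivity)) this
        _ = _ := by ring
    have h2 : (pp.2.1 : ℝ) * pp.2.2 ≤ 2 * A * pp.2.2 := by nlinarith
    have h3 : (pp.1.1 : ℝ) * pp.1.2 ≤ 2 * A * pp.1.2 := by nlinarith
    have h4 : (2 : ℝ) * A * pp.2.2 ≤ 2 * A / C * (pp.1.2 * pp.2.2) := by
      rw [div_mul_eq_mul_div, le_div_iff₀ hC]
      calc (2 : ℝ) * A * pp.2.2 * C ≤ 2 * A * pp.2.2 * pp.1.2 := by gcongr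
        _ = 2 * A * (pp.1.2 * pp.2.2) := by ring
    have h5 : (2 : ℝ) * A * pp.1.2 ≤ 2 * A / C * (pp.1.2 * pp.2.2) := by
      rw [div_mul_eq_mul_div, le_div_iff₀ hC]
      calc (2 : ℝ) * A * pp.1.2 * C ≤ 2 * A * pp.1.2 * pp.2.2 := by gcongr
        _ = 2 * A * (pp.1.2 * pp.2.2) := by ring
    have htot : |(γ.b : ℝ)| * (pp.1.2 * pp.2.2) ≤
        (4 * |(γ.c : ℝ)| * A ^ 2 / C ^ 2 + 4 * A / C) * (pp.1.2 * pp.2.2) := by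
      calc |(γ.b : ℝ)| * (pp.1.2 * pp.2.2)
          ≤ |(γ.c : ℝ)| * (2 * A / C * pp.1.2) * (2 * A / C * pp.2.2)
            + 2 * A / C * (pp.1.2 * pp.2.2) + 2 * A / C * (pp.1.2 * pp.2.2) := by linarith
        _ = (4 * |(γ.c : ℝ)| * A ^ 2 / C ^ 2 + 4 * A / C) * (pp.1.2 * pp.2.2) := by ring
    exact le_of_mul_le_mul_right htot (mul_pos hq hq')
  -- hence `|bc| ≤ 4w² + 4w` and `W ≤ w`
  have hbc : |(γ.b : ℝ) * γ.c| ≤ 4 * w ^ 2 + 4 * w := by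
    rw [abs_mul, hw]
    calc |(γ.b : ℝ)| * |(γ.c : ℝ)| ≤ (4 * |(γ.c : ℝ)| * A ^ 2 / C ^ 2 + 4 * A / C) * |(γ.c : ℝ)| := by
          gcongr
      _ = 4 * (|(γ.c : ℝ)| * A / C) ^ 2 + 4 * (|(γ.c : ℝ)| * A / C) := by ring
  have hWw : W ≤ w := by
    rcases le_or_gt W w with hle | hlt
    · exact hle
    · have : 4 * w ^ 2 + 4 * w < 4 * W ^ 2 + 4 * W := by nlinarith
      linarith
  have hw1 : 1 ≤ w := hW.trans hWw
  have hWC : W * C ≤ |(γ.c : ℝ)| * A := by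
    have := mul_le_mul_of_nonneg_right hWw hC.le
    rwa [hw, div_mul_cancel₀ _ hC.ne'] at this
  refine ⟨hWC, ?_, ?_⟩
  · -- `|a| q₁ = |c r₁ + q| ≤ 2A|c| + 2C`, `q₁ > C`
    have e3' : (γ.a : ℝ) * pp.2.2 = γ.c * pp.2.1 + pp.1.2 := by exact_mod_cast e3
    have h1 : |(γ.a : ℝ)| * C ≤ |(γ.a : ℝ)| * pp.2.2 := by gcongr
    have h2 : |(γ.a : ℝ)| * pp.2.2 ≤ |(γ.c : ℝ)| * (2 * A) + 2 * C := by
      rw [← abs_of_pos hq', ← abs_mul, e3']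
      calc |(γ.c : ℝ) * pp.2.1 + pp.1.2| ≤ |(γ.c : ℝ) * pp.2.1| + |(pp.1.2 : ℝ)| := abs_add_le _ _
        _ = |(γ.c : ℝ)| * pp.2.1 + pp.1.2 := by rw [abs_mul, abs_of_pos hr', abs_of_pos hq]
        _ ≤ |(γ.c : ℝ)| * (2 * A) + 2 * C := by gcongr
    rw [le_div_iff₀ hC]
    have h3 : (2 : ℝ) * C ≤ 2 * (|(γ.c : ℝ)| * A) := by
      have : C ≤ w * C := le_mul_of_one_le_left hC.le hw1
      rw [hw, div_mul_cancel₀ _ hC.ne'] at this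
      linarith
    linarith
  · have e4' : (γ.d : ℝ) * pp.1.2 = pp.2.2 - γ.c * pp.1.1 := by exact_mod_cast e4
    have h1 : |(γ.d : ℝ)| * C ≤ |(γ.d : ℝ)| * pp.1.2 := by gcongr
    have h2 : |(γ.d : ℝ)| * pp.1.2 ≤ 2 * C + |(γ.c : ℝ)| * (2 * A) := by
      rw [← abs_of_pos hq, ← abs_mul, e4']
      calc |(pp.2.2 : ℝ) - γ.c * pp.1.1| ≤ |(pp.2.2 : ℝ)| + |(γ.c : ℝ) * pp.1.1| := abs_sub _ _
        _ = pp.2.2 + |(γ.c : ℝ)| * pp.1.1 := by rw [abs_mul, abs_of_pos hr, abs_of_pos hq']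
        _ ≤ 2 * C + |(γ.c : ℝ)| * (2 * A) := by gcongr
    rw [le_div_iff₀ hC]
    have h3 : (2 : ℝ) * C ≤ 2 * (|(γ.c : ℝ)| * A) := by
      have : C ≤ w * C := le_mul_of_one_le_left hC.le hw1
      rw [hw, div_mul_cancel₀ _ hC.ne'] at this
      linarith
    linarith

end Cases


/-! ### The heart of the matter: pairs sharing a matrix with `|c|` large are close -/

section Fiber

variable {A C Δ₂ H C₀ : ℝ} {I : Set ℝ} {h h' : ℝ → ℝ}

/-- An affine function on a segment is at least the smaller of its end values. [folklore] -/
theorem min_le_affine (c d x x' t : ℝ) (ht : t ∈ Icc x x') :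
    min (c * x + d) (c * x' + d) ≤ c * t + d := by
  rcases le_or_gt 0 c with hc | hc
  · exact (min_le_left _ _).trans (by nlinarith [ht.1])
  · exact (min_le_right _ _).trans (by nlinarith [ht.2])

/-- `|u + v - w| ≥ |u| - |v| - |w|`. [folklore] -/
theorem abs_add_sub_ge (u v w : ℝ) : |u| - |v| - |w| ≤ |u + v - w| := by
  have h1 : |u| ≤ |u + v - w| + |w - v| := by
    calc |u| = |(u + v - w) + (w - v)| := by ring_nf
      _ ≤ |u + v - w| + |w - v| := abs_add_le _ _
  have h2 : |w - v| ≤ |w| + |v| := abs_sub _ _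
  linarith

/-- **The resonance step of Graham–Kolesnik's proof of Lemma 7.18** ((7.5.10)–(7.5.11)): let
`γ = (a b; c d)` be unimodular with `|c| ≥ 12 C₀² C / A`, and let `r/q < r'/q'` be two points of
`𝓟` whose images `γ(r/q)`, `γ(r'/q')` are again points of `𝓟`, both pairs satisfying (7.5.3). Then
`r'/q' - r/q ≤ 4 C₀ Δ₂ / |c|`: the function `g(x) = (cx + d) h(γx) - h(x)` has `|g| ≤ H Δ₂` at both
points and `|g'| ≥ |c| H / (2 C₀)` in between. [cite: GrahamKolesnik1991, Lemma 7.18, proof, (7.5.10)–(7.5.11)] -/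
theorem fiber_diam (hh : IsSpacingFn A C H C₀ I h h') (hA : 0 < A) (hC : 0 < C) (hC₀ : 0 < C₀)
    (hH : 0 < H) (γ : TMat) (hγ : γ.det = 1) (hcW : 12 * C₀ ^ 2 * C ≤ |(γ.c : ℝ)| * A)
    {p p' : ℤ × ℤ} (hp : p ∈ points A C I) (hp₁ : γ.apply p ∈ points A C I)
    (hcl : HClose C H Δ₂ h p (γ.apply p)) (hp' : p' ∈ points A C I)
    (hp₁' : γ.apply p' ∈ points A C I) (hcl' : HClose C H Δ₂ h p' (γ.apply p'))
    (hlt : (p.1 : ℝ) / p.2 < (p'.1 : ℝ) / p'.2) :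
    (p'.1 : ℝ) / p'.2 - p.1 / p.2 ≤ 4 * C₀ * Δ₂ / |(γ.c : ℝ)| := by
  rw [mem_points] at hp hp₁ hp' hp₁'
  obtain ⟨-, ⟨hq1, hq2⟩, -, hxI⟩ := hp
  obtain ⟨-, ⟨hq1a, -⟩, -, hx₁I⟩ := hp₁
  obtain ⟨-, ⟨hq1', hq2'⟩, -, hxI'⟩ := hp'
  obtain ⟨-, ⟨hq1a', -⟩, -, hx₁I'⟩ := hp₁'
  unfold HClose at hcl hcl'
  simp only [TMat.apply_fst, TMat.apply_snd, Int.cast_add, Int.cast_mul] at hq1a hx₁I hq1a' hx₁I'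
  simp only [TMat.apply_fst, TMat.apply_snd, Int.cast_add, Int.cast_mul] at hcl hcl'
  -- notation
  set x : ℝ := (p.1 : ℝ) / p.2 with hx
  set x' : ℝ := (p'.1 : ℝ) / p'.2 with hx'
  have hq : (0 : ℝ) < p.2 := hC.trans hq1
  have hq' : (0 : ℝ) < p'.2 := hC.trans hq1'
  have hcpos : 0 < |(γ.c : ℝ)| := by
    have : 0 < |(γ.c : ℝ)| * A := lt_of_lt_of_le (by positivity) hcW
    exact pos_of_mul_pos_left this hA.le
  have hΔ₂ : 0 ≤ H * Δ₂ := by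
    have h0 : 0 ≤ C * H * Δ₂ := (abs_nonneg _).trans hcl
    rw [mul_assoc] at h0
    exact nonneg_of_mul_nonneg_right h0 hC
  -- the denominators `φ(t) = c t + d`
  obtain ⟨φ, hφ⟩ : ∃ φ : ℝ → ℝ, φ = fun t => (γ.c : ℝ) * t + γ.d := ⟨_, rfl⟩
  have hφt : ∀ t, φ t = (γ.c : ℝ) * t + γ.d := fun t => by rw [hφ]
  have hφx : φ x = (γ.c * p.1 + γ.d * p.2) / p.2 := by
    rw [hφt, hx]; field_simp
  have hφx' : φ x' = (γ.c * p'.1 + γ.d * p'.2) / p'.2 := by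
    rw [hφt, hx']; field_simp
  have hφx_gt : 1 / 2 < φ x := by
    rw [hφx, lt_div_iff₀ hq]; linarith
  have hφx'_gt : 1 / 2 < φ x' := by
    rw [hφx', lt_div_iff₀ hq']; linarith
  have hφpos : ∀ t ∈ Icc x x', 1 / 2 < φ t := fun t ht => by
    have h0 := min_le_affine (γ.c : ℝ) γ.d x x' t ht
    rw [← hφt, ← hφt, ← hφt] at h0
    exact lt_of_lt_of_le (lt_min hφx_gt hφx'_gt) h0
  have hφne' : ∀ t ∈ Icc x x', (γ.c : ℝ) * t + γ.d ≠ 0 := fun t ht => by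
    rw [← hφt]; linarith [hφpos t ht]
  -- the Möbius images
  have hmx : γ.moeb x = (γ.a * p.1 + γ.b * p.2) / (γ.c * p.1 + γ.d * p.2) :=
    γ.moeb_div hq.ne' (by intro h0; rw [h0, zero_div] at hφx; linarith [hφx_gt.trans_le hφx.le])
  have hmx' : γ.moeb x' = (γ.a * p'.1 + γ.b * p'.2) / (γ.c * p'.1 + γ.d * p'.2) :=
    γ.moeb_div hq'.ne' (by intro h0; rw [h0, zero_div] at hφx'; linarith [hφx'_gt.trans_le hφx'.le])
  rw [← hmx] at hx₁I hcl
  rw [← hmx'] at hx₁I' hcl'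
  -- monotonicity of `γ` on the segment
  have hmono : ∀ s ∈ Icc x x', ∀ t ∈ Icc x x', s ≤ t → γ.moeb s ≤ γ.moeb t := by
    intro s hs t ht hst
    have e := γ.moeb_sub hγ (hφne' t ht) (hφne' s hs)
    have hpos : 0 < ((γ.c : ℝ) * t + γ.d) * ((γ.c : ℝ) * s + γ.d) := by
      rw [← hφt, ← hφt]; exact mul_pos (by linarith [hφpos t ht]) (by linarith [hφpos s hs])
    have : 0 ≤ γ.moeb t - γ.moeb s := by rw [e]; exact div_nonneg (sub_nonneg.2 hst) hpos.le
    linarith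
  have hsmono : ∀ s ∈ Icc x x', ∀ t ∈ Icc x x', s < t → γ.moeb s < γ.moeb t := by
    intro s hs t ht hst
    have e := γ.moeb_sub hγ (hφne' t ht) (hφne' s hs)
    have hpos : 0 < ((γ.c : ℝ) * t + γ.d) * ((γ.c : ℝ) * s + γ.d) := by
      rw [← hφt, ← hφt]; exact mul_pos (by linarith [hφpos t ht]) (by linarith [hφpos s hs])
    have : 0 < γ.moeb t - γ.moeb s := by rw [e]; exact div_pos (sub_pos.2 hst) hpos
    linarith
  have hxmem : x ∈ Icc x x' := ⟨le_rfl, hlt.le⟩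
  have hx'mem : x' ∈ Icc x x' := ⟨hlt.le, le_rfl⟩
  have hIsub : Icc (γ.moeb x) (γ.moeb x') ⊆ I := hh.ordConnected.out hx₁I hx₁I'
  have hmaps : MapsTo γ.moeb (Icc x x') I := fun t ht =>
    hIsub ⟨hmono x hxmem t ht ht.1, hmono t ht x' hx'mem ht.2⟩
  have hsub : Icc x x' ⊆ I := hh.ordConnected.out hxI hxI'
  -- the auxiliary function `g` and its derivative `g'`
  obtain ⟨g, hg⟩ : ∃ g : ℝ → ℝ, g = fun t => φ t * (h ∘ γ.moeb) t - h t := ⟨_, rfl⟩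
  obtain ⟨g', hg'⟩ : ∃ g' : ℝ → ℝ, g' = fun t =>
      (γ.c : ℝ) * (h ∘ γ.moeb) t + φ t * (h' (γ.moeb t) * (1 / ((γ.c : ℝ) * t + γ.d) ^ 2)) - h' t :=
    ⟨_, rfl⟩
  have hgt : ∀ t, g t = φ t * h (γ.moeb t) - h t := fun t => by rw [hg]; rfl
  have hg't : ∀ t, g' t =
      (γ.c : ℝ) * h (γ.moeb t) + φ t * (h' (γ.moeb t) * (1 / ((γ.c : ℝ) * t + γ.d) ^ 2)) - h' t :=
    fun t => by rw [hg']; rfl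
  have hhc : ContinuousOn h I := fun y hy => (hh.hasDerivWithinAt y hy).continuousWithinAt
  have hφc : Continuous φ := by rw [hφ]; fun_prop
  have hmoebc : ContinuousOn γ.moeb (Icc x x') := by
    have e : γ.moeb = fun t => ((γ.a : ℝ) * t + γ.b) / ((γ.c : ℝ) * t + γ.d) := rfl
    rw [e]
    exact ContinuousOn.div (by fun_prop) (by fun_prop) hφne'
  have hgc : ContinuousOn g (Icc x x') := by
    rw [hg]
    exact (hφc.continuousOn.mul (hhc.comp hmoebc hmaps)).sub (hhc.mono hsub)
  have hgd : ∀ t ∈ Ioo x x', HasDerivAt g (g' t) t := by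
    intro t ht
    have htc : t ∈ Icc x x' := Ioo_subset_Icc_self ht
    have hφt0 : (γ.c : ℝ) * t + γ.d ≠ 0 := hφne' t htc
    have hmo : HasDerivAt γ.moeb (1 / ((γ.c : ℝ) * t + γ.d) ^ 2) t := γ.hasDerivAt_moeb hγ hφt0
    have hmt1 : γ.moeb x < γ.moeb t := hsmono x hxmem t htc ht.1
    have hmt2 : γ.moeb t < γ.moeb x' := hsmono t htc x' hx'mem ht.2
    have hnhds : I ∈ nhds (γ.moeb t) :=
      Filter.mem_of_superset (Ioo_mem_nhds hmt1 hmt2) (Ioo_subset_Icc_self.trans hIsub)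
    have hhm : HasDerivAt h (h' (γ.moeb t)) (γ.moeb t) :=
      (hh.hasDerivWithinAt _ (hmaps htc)).hasDerivAt hnhds
    have hcomp : HasDerivAt (h ∘ γ.moeb) (h' (γ.moeb t) * (1 / ((γ.c : ℝ) * t + γ.d) ^ 2)) t :=
      hhm.comp t hmo
    have hφd : HasDerivAt φ (γ.c : ℝ) t := by
      rw [hφ]
      simpa using ((hasDerivAt_id t).const_mul (γ.c : ℝ)).add_const (γ.d : ℝ)
    have hnhds' : I ∈ nhds t :=
      Filter.mem_of_superset (Ioo_mem_nhds ht.1 ht.2) (Ioo_subset_Icc_self.trans hsub)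
    have hht : HasDerivAt h (h' t) t := (hh.hasDerivWithinAt t (hsub htc)).hasDerivAt hnhds'
    rw [hg, hg']
    exact (hφd.mul hcomp).sub hht
  -- lower bound for `|g'|` on the open segment
  have hm : ∀ t ∈ Ioo x x', |(γ.c : ℝ)| * H / (2 * C₀) ≤ |g' t| := by
    intro t ht
    have htc : t ∈ Icc x x' := Ioo_subset_Icc_self ht
    have hφt1 : 1 / 2 < (γ.c : ℝ) * t + γ.d := by rw [← hφt]; exact hφpos t htc
    have hmtI : γ.moeb t ∈ I := hmaps htc
    have htI : t ∈ I := hsub htc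
    have h1 : 2 * (|(γ.c : ℝ)| * H / (2 * C₀)) ≤ |(γ.c : ℝ) * h (γ.moeb t)| := by
      rw [abs_mul]
      calc 2 * (|(γ.c : ℝ)| * H / (2 * C₀)) = |(γ.c : ℝ)| * (H / C₀) := by field_simp
        _ ≤ |(γ.c : ℝ)| * |h (γ.moeb t)| :=
          mul_le_mul_of_nonneg_left ((hh.le_h _ hmtI).trans (le_abs_self _)) (abs_nonneg _)
    have h2 : |φ t * (h' (γ.moeb t) * (1 / ((γ.c : ℝ) * t + γ.d) ^ 2))| ≤
        2 * (2 * C₀ * H * C / A) := by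
      have e : φ t * (h' (γ.moeb t) * (1 / ((γ.c : ℝ) * t + γ.d) ^ 2)) =
          h' (γ.moeb t) / ((γ.c : ℝ) * t + γ.d) := by
        rw [hφt]; field_simp
      have hpos : (0 : ℝ) < (γ.c : ℝ) * t + γ.d := by linarith
      rw [e, abs_div, abs_of_pos hpos, div_le_iff₀ hpos]
      have h0 := hh.abs_deriv_le' hA hC hmtI
      have h0' : 0 ≤ 2 * C₀ * H * C / A := (abs_nonneg _).trans h0
      nlinarith
    have h3 : |h' t| ≤ 2 * C₀ * H * C / A := hh.abs_deriv_le' hA hC htI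
    have h4 := abs_add_sub_ge ((γ.c : ℝ) * h (γ.moeb t))
      (φ t * (h' (γ.moeb t) * (1 / ((γ.c : ℝ) * t + γ.d) ^ 2))) (h' t)
    have h5 : 3 * (2 * C₀ * H * C / A) ≤ |(γ.c : ℝ)| * H / (2 * C₀) := by
      rw [mul_div_assoc', div_le_div_iff₀ hA (by positivity)]
      nlinarith [hH.le]
    rw [hg't]
    linarith
  -- values of `g` at the end points
  have hgx : |g x| ≤ H * Δ₂ := by
    have e : g x = -(((p.2 : ℝ) * h x - (γ.c * p.1 + γ.d * p.2) * h (γ.moeb x)) / p.2) := by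
      rw [hgt, hφx]
      field_simp
      ring
    rw [e, abs_neg, abs_div, abs_of_pos hq, div_le_iff₀ hq]
    calc |(p.2 : ℝ) * h x - (γ.c * p.1 + γ.d * p.2) * h (γ.moeb x)| ≤ C * H * Δ₂ := hcl
      _ = (H * Δ₂) * C := by ring
      _ ≤ (H * Δ₂) * p.2 := by gcongr
  have hgx' : |g x'| ≤ H * Δ₂ := by
    have e : g x' = -(((p'.2 : ℝ) * h x' - (γ.c * p'.1 + γ.d * p'.2) * h (γ.moeb x')) / p'.2) := by
      rw [hgt, hφx']
      field_simp
      ring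
    rw [e, abs_neg, abs_div, abs_of_pos hq', div_le_iff₀ hq']
    calc |(p'.2 : ℝ) * h x' - (γ.c * p'.1 + γ.d * p'.2) * h (γ.moeb x')| ≤ C * H * Δ₂ := hcl'
      _ = (H * Δ₂) * C := by ring
      _ ≤ (H * Δ₂) * p'.2 := by gcongr
  -- mean value theorem
  have hmvt := mvt_abs_lower hlt.le hgc hgd hm
  have hgg : |g x' - g x| ≤ 2 * (H * Δ₂) := by
    calc |g x' - g x| ≤ |g x'| + |g x| := abs_sub _ _
      _ ≤ H * Δ₂ + H * Δ₂ := add_le_add hgx' hgx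
      _ = 2 * (H * Δ₂) := by ring
  have key : |(γ.c : ℝ)| * H / (2 * C₀) * (x' - x) ≤ 2 * (H * Δ₂) := hmvt.trans hgg
  rw [le_div_iff₀ hcpos]
  rw [div_mul_eq_mul_div, div_le_iff₀ (by positivity)] at key
  have key2 : H * ((x' - x) * |(γ.c : ℝ)|) ≤ H * (4 * C₀ * Δ₂) :=
    calc H * ((x' - x) * |(γ.c : ℝ)|) = |(γ.c : ℝ)| * H * (x' - x) := by ring
      _ ≤ 2 * (H * Δ₂) * (2 * C₀) := key
      _ = H * (4 * C₀ * Δ₂) := by ring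
  exact le_of_mul_le_mul_left key2 hH

/-- **Points sharing a matrix.** For `γ` unimodular with `|c| A ≥ 12 C₀² C`, a set `F` of points
`p ∈ 𝓟` with `γ p ∈ 𝓟` and `(p, γ p)` satisfying (7.5.3) has
`#F ≤ 16 C₀ C² Δ₂ / |c| + 1` (G–K: "for fixed `a, b, c, d` … there are `≪ 1 + Δ₂ |c|⁻¹ C²` pairs").
[cite: GrahamKolesnik1991, Lemma 7.18, proof, after (7.5.11)] -/
theorem fiber_card_le (hh : IsSpacingFn A C H C₀ I h h') (hA : 0 < A) (hC : 0 < C) (hC₀ : 0 < C₀)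
    (hH : 0 < H) (hΔ₂ : 0 ≤ Δ₂) (γ : TMat) (hγ : γ.det = 1)
    (hcW : 12 * C₀ ^ 2 * C ≤ |(γ.c : ℝ)| * A) (F : Finset (ℤ × ℤ))
    (hF : ∀ p ∈ F, p ∈ points A C I ∧ γ.apply p ∈ points A C I ∧ HClose C H Δ₂ h p (γ.apply p)) :
    (F.card : ℝ) ≤ 16 * C₀ * C ^ 2 * Δ₂ / |(γ.c : ℝ)| + 1 := by
  classical
  have hcpos : 0 < |(γ.c : ℝ)| := by
    have : 0 < |(γ.c : ℝ)| * A := lt_of_lt_of_le (by positivity) hcW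
    exact pos_of_mul_pos_left this hA.le
  set f : ℤ × ℤ → ℝ := fun p => (p.1 : ℝ) / p.2 with hf
  have hinj : Set.InjOn f F := by
    intro p hp p' hp' hpp'
    by_contra hne
    have := points_spacing (hF p hp).1 (hF p' hp').1 hne hC
    simp only [hf] at hpp'
    rw [hpp', sub_self, abs_zero] at this
    have : (0 : ℝ) < 1 / (4 * C ^ 2) := by positivity
    linarith
  have hcard : (F.image f).card = F.card := Finset.card_image_of_injOn hinj
  rw [← hcard]
  have key := card_le_of_spacing (F.image f) (δ := 1 / (4 * C ^ 2)) (L := 4 * C₀ * Δ₂ / |(γ.c : ℝ)|)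
    (by positivity) (by positivity) ?_ ?_
  · refine key.trans (le_of_eq ?_)
    field_simp
    ring
  · intro a ha b hb hab
    rw [Finset.mem_image] at ha hb
    obtain ⟨p, hp, rfl⟩ := ha
    obtain ⟨p', hp', rfl⟩ := hb
    have hne : p ≠ p' := fun h => hab (by rw [h])
    exact points_spacing (hF p hp).1 (hF p' hp').1 hne hC
  · intro a ha b hb
    rw [Finset.mem_image] at ha hb
    obtain ⟨p, hp, rfl⟩ := ha
    obtain ⟨p', hp', rfl⟩ := hb
    rcases le_or_gt (f p) (f p') with hle | hlt
    · exact (sub_nonpos.2 hle).trans (by positivity)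
    · obtain ⟨hp1, hp2, hp3⟩ := hF p hp
      obtain ⟨hp1', hp2', hp3'⟩ := hF p' hp'
      exact fiber_diam hh hA hC hC₀ hH γ hγ hcW hp1' hp2' hp3' hp1 hp2 hp3 hlt

end Fiber


/-! ### Counting matrices -/

section Counting

/-- An injectivity-based bound: if on `G` the matrix `M pp` carries `pp.1` to `pp.2` and is
determined by a key with values in `S`, then `#G ≤ #S · #P`. [folklore] -/
theorem card_le_of_key {κ : Type*} [DecidableEq κ] (G : Finset ((ℤ × ℤ) × (ℤ × ℤ)))
    (P : Finset (ℤ × ℤ)) (S : Finset κ) (key : (ℤ × ℤ) × (ℤ × ℤ) → κ)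
    (M : (ℤ × ℤ) × (ℤ × ℤ) → TMat) (hP : ∀ pp ∈ G, pp.1 ∈ P) (hS : ∀ pp ∈ G, key pp ∈ S)
    (happ : ∀ pp ∈ G, (M pp).apply pp.1 = pp.2)
    (hdet : ∀ pp ∈ G, ∀ pp' ∈ G, key pp = key pp' → M pp = M pp') :
    G.card ≤ S.card * P.card := by
  rw [← Finset.card_product]
  refine Finset.card_le_card_of_injOn (fun pp => (key pp, pp.1)) (fun pp hpp => ?_) ?_
  · exact Finset.mem_product.2 ⟨hS pp hpp, hP pp hpp⟩
  · intro pp hpp pp' hpp' heq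
    simp only [Prod.mk.injEq] at heq
    obtain ⟨hk, h1⟩ := heq
    have hM := hdet pp hpp pp' hpp' hk
    refine Prod.ext h1 ?_
    rw [← happ pp hpp, ← happ pp' hpp', hM, h1]

/-- Matrices with fixed `c ≠ 0`, determinant `1` and `|a|, |d| ≤ R` number at most
`(2R + 1)(2R/|c| + 1)`: for fixed `a` the entries `d` lie in one residue class modulo `c`.
[cite: GrahamKolesnik1991, Lemma 7.18, proof, last display] -/
theorem card_fixed_c_le (T : Finset TMat) (c : ℤ) (hc : c ≠ 0) (R : ℝ) (hR : 0 ≤ R)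
    (hT : ∀ γ ∈ T, γ.det = 1 ∧ γ.c = c ∧ |(γ.a : ℝ)| ≤ R ∧ |(γ.d : ℝ)| ≤ R) :
    (T.card : ℝ) ≤ (2 * R + 1) * (2 * R / |(c : ℝ)| + 1) := by
  classical
  have hmaps : ∀ γ ∈ T, γ.a ∈ Finset.Icc (-⌊R⌋) ⌊R⌋ := by
    intro γ hγ
    have h := (hT γ hγ).2.2.1
    rw [abs_le] at h
    rw [Finset.mem_Icc, Int.le_floor, ← Int.cast_le (R := ℝ), Int.cast_neg]
    constructor
    · have : -⌊R⌋ ≤ γ.a := by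
        rw [neg_le, Int.le_floor, Int.cast_neg]; linarith [h.1]
      exact_mod_cast this
    · exact h.2
  rw [Finset.card_eq_sum_card_fiberwise (f := fun γ : TMat => γ.a) (t := Finset.Icc (-⌊R⌋) ⌊R⌋)
    (fun γ hγ => hmaps γ hγ)]
  push_cast
  have hfib : ∀ a ∈ Finset.Icc (-⌊R⌋) ⌊R⌋,
      (((T.filter fun γ => γ.a = a).card : ℕ) : ℝ) ≤ 2 * R / |(c : ℝ)| + 1 := by
    intro a _
    set Ta := T.filter fun γ => γ.a = a with hTa
    rcases Ta.eq_empty_or_nonempty with he | ⟨γ₀, hγ₀⟩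
    · rw [he]; simp; positivity
    have hγ₀' := Finset.mem_filter.1 hγ₀
    -- `γ ↦ γ.d` is injective on `Ta`
    have hinj : Set.InjOn (fun γ : TMat => γ.d) Ta := by
      intro γ hγ γ' hγ' hdd
      have h1 := Finset.mem_filter.1 hγ
      have h2 := Finset.mem_filter.1 hγ'
      obtain ⟨hd1, hc1, -, -⟩ := hT γ h1.1
      obtain ⟨hd2, hc2, -, -⟩ := hT γ' h2.1
      unfold TMat.det at hd1 hd2
      simp only at hdd
      have hb : γ.b * c = γ'.b * c := by
        rw [hc1] at hd1; rw [hc2] at hd2; rw [h1.2] at hd1; rw [h2.2, ← hdd] at hd2; linarith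
      have hb' := mul_right_cancel₀ hc hb
      exact TMat.ext (h1.2.trans h2.2.symm) hb' (hc1.trans hc2.symm) hdd
    have hcard : (Ta.image fun γ : TMat => γ.d).card = Ta.card := Finset.card_image_of_injOn hinj
    rw [← hcard]
    refine card_filter_modEq_le hc ⌊R⌋ (Int.floor_nonneg.2 hR) γ₀.d _ ?_ |>.trans ?_
    · intro d hd
      rw [Finset.mem_image] at hd
      obtain ⟨γ, hγ, rfl⟩ := hd
      have h1 := Finset.mem_filter.1 hγ
      obtain ⟨hd1, hc1, -, hdR⟩ := hT γ h1.1
      obtain ⟨hd0, hc0, -, -⟩ := hT γ₀ hγ₀'.1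
      rw [abs_le] at hdR
      refine ⟨?_, ?_, ?_⟩
      · have : -⌊R⌋ ≤ γ.d := by
          rw [neg_le, Int.le_floor, Int.cast_neg]; linarith [hdR.1]
        exact this
      · exact Int.le_floor.2 hdR.2
      · -- `d ≡ d₀ (mod c)`: `a (d - d₀) = (b - b₀) c` with `gcd(a, c) = 1`
        unfold TMat.det at hd1 hd0
        rw [hc1, h1.2] at hd1
        rw [hc0, hγ₀'.2] at hd0
        have hcop : IsCoprime c a := ⟨-γ.b, γ.d, by linarith⟩
        have hdvd : c ∣ a * (γ₀.d - γ.d) := ⟨γ₀.b - γ.b, by linarith⟩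
        exact Int.modEq_iff_dvd.2 (hcop.dvd_of_dvd_mul_left hdvd)
    · gcongr
      exact Int.floor_le R
  calc ∑ a ∈ Finset.Icc (-⌊R⌋) ⌊R⌋, (((T.filter fun γ => γ.a = a).card : ℕ) : ℝ)
      ≤ ∑ _a ∈ Finset.Icc (-⌊R⌋) ⌊R⌋, (2 * R / |(c : ℝ)| + 1) := Finset.sum_le_sum hfib
    _ = ((Finset.Icc (-⌊R⌋) ⌊R⌋).card : ℝ) * (2 * R / |(c : ℝ)| + 1) := by
        rw [Finset.sum_const, nsmul_eq_mul]
    _ ≤ (2 * R + 1) * (2 * R / |(c : ℝ)| + 1) := by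
        gcongr
        rw [Int.card_Icc]
        have h0 : (0 : ℤ) ≤ ⌊R⌋ := Int.floor_nonneg.2 hR
        have : ((⌊R⌋ + 1 - -⌊R⌋).toNat : ℝ) = 2 * (⌊R⌋ : ℝ) + 1 := by
          have e : (((⌊R⌋ + 1 - -⌊R⌋).toNat : ℤ) : ℝ) = ((⌊R⌋ + 1 - -⌊R⌋ : ℤ) : ℝ) := by
            rw [Int.toNat_of_nonneg (by omega)]
          rw [Int.cast_natCast] at e
          rw [e]; push_cast; ring
        rw [this]
        linarith [Int.floor_le R]


/-- Membership of an integer of modulus `≤ L` in `Icc (-⌊L⌋) ⌊L⌋`. [folklore] -/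
theorem mem_Icc_of_abs_le {z : ℤ} {L : ℝ} (h : |(z : ℝ)| ≤ L) : z ∈ Finset.Icc (-⌊L⌋) ⌊L⌋ := by
  rw [abs_le] at h
  rw [Finset.mem_Icc, Int.le_floor]
  refine ⟨?_, h.2⟩
  rw [neg_le, Int.le_floor, Int.cast_neg]; linarith [h.1]

/-- `#Icc (-⌊L⌋) ⌊L⌋ ≤ 2L + 1` for `L ≥ 0`. [folklore] -/
theorem card_Icc_neg_floor_le {L : ℝ} (hL : 0 ≤ L) :
    ((Finset.Icc (-⌊L⌋) ⌊L⌋).card : ℝ) ≤ 2 * L + 1 := by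
  rw [Int.card_Icc]
  have h0 : (0 : ℤ) ≤ ⌊L⌋ := Int.floor_nonneg.2 hL
  have e : (((⌊L⌋ + 1 - -⌊L⌋).toNat : ℤ) : ℝ) = ((⌊L⌋ + 1 - -⌊L⌋ : ℤ) : ℝ) := by
    rw [Int.toNat_of_nonneg (by omega)]
  rw [Int.cast_natCast] at e
  rw [e]; push_cast; linarith [Int.floor_le L]

/-- `#(Icc (-⌊L⌋) ⌊L⌋ ∖ {0}) ≤ 2L` for `L ≥ 0`. [folklore] -/
theorem card_Icc_erase_zero_le {L : ℝ} (hL : 0 ≤ L) :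
    (((Finset.Icc (-⌊L⌋) ⌊L⌋).erase 0).card : ℝ) ≤ 2 * L := by
  have h0 : (0 : ℤ) ≤ ⌊L⌋ := Int.floor_nonneg.2 hL
  have hmem : (0 : ℤ) ∈ Finset.Icc (-⌊L⌋) ⌊L⌋ := by rw [Finset.mem_Icc]; omega
  rw [Finset.card_erase_of_mem hmem, Nat.cast_sub (Finset.card_pos.2 ⟨0, hmem⟩), Nat.cast_one,
    Int.card_Icc]
  have e : (((⌊L⌋ + 1 - -⌊L⌋).toNat : ℤ) : ℝ) = ((⌊L⌋ + 1 - -⌊L⌋ : ℤ) : ℝ) := by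
    rw [Int.toNat_of_nonneg (by omega)]
  rw [Int.cast_natCast] at e
  rw [e]; push_cast; linarith [Int.floor_le L]

/-- **Summing over the big matrices** (the last display of Graham–Kolesnik's proof, with the
factor `E/|c| + 1` coming from `fiber_card_le`): for unimodular matrices with `1 ≤ W ≤ |c| A / C`,
`|c| ≤ 4 Δ₁ C²`, `|a|, |d| ≤ 4 |c| A / C`,
`∑_γ (E/|c_γ| + 1) ≤ 8 Δ₁ C² · 9 (A/C) (8A/C + 1) (E + 4 Δ₁ C²)`.
[cite: GrahamKolesnik1991, Lemma 7.18, proof, last display] -/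
theorem sum_big_le (T : Finset TMat) {A C Δ₁ W E : ℝ} (hA : 0 < A) (hC : 0 < C) (hΔ₁ : 0 ≤ Δ₁)
    (hW : 1 ≤ W) (hE : 0 ≤ E)
    (hT : ∀ γ ∈ T, γ.det = 1 ∧ γ.c ≠ 0 ∧ W * C ≤ |(γ.c : ℝ)| * A ∧ |(γ.c : ℝ)| ≤ 4 * Δ₁ * C ^ 2 ∧
      |(γ.a : ℝ)| ≤ 4 * |(γ.c : ℝ)| * A / C ∧ |(γ.d : ℝ)| ≤ 4 * |(γ.c : ℝ)| * A / C) :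
    ∑ γ ∈ T, (E / |(γ.c : ℝ)| + 1) ≤
      8 * Δ₁ * C ^ 2 * (9 * (A / C) * (8 * A / C + 1) * (E + 4 * Δ₁ * C ^ 2)) := by
  classical
  set L : ℝ := 4 * Δ₁ * C ^ 2 with hL
  have hL0 : 0 ≤ L := by positivity
  set Cset : Finset ℤ := (Finset.Icc (-⌊L⌋) ⌊L⌋).erase 0 with hCset
  have hmaps : ∀ γ ∈ T, γ.c ∈ Cset := fun γ hγ =>
    Finset.mem_erase.2 ⟨(hT γ hγ).2.1, mem_Icc_of_abs_le (hT γ hγ).2.2.2.1⟩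
  rw [← Finset.sum_fiberwise_of_maps_to hmaps]
  set U : ℝ := 9 * (A / C) * (8 * A / C + 1) * (E + 4 * Δ₁ * C ^ 2) with hU
  have hU0 : 0 ≤ U := by positivity
  have hinner : ∀ c ∈ Cset, ∑ γ ∈ T with γ.c = c, (E / |(γ.c : ℝ)| + 1) ≤ U := by
    intro c hc
    have hc0 : c ≠ 0 := (Finset.mem_erase.1 hc).1
    have hc0' : (0 : ℝ) < |(c : ℝ)| := abs_pos.2 (by exact_mod_cast hc0)
    set Tc := T.filter fun γ => γ.c = c with hTc
    rcases Tc.eq_empty_or_nonempty with he | ⟨γ₀, hγ₀⟩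
    · rw [he, Finset.sum_empty]; exact hU0
    have hγ₀' := Finset.mem_filter.1 hγ₀
    obtain ⟨-, -, hWc, hcL, -, -⟩ := hT γ₀ hγ₀'.1
    rw [hγ₀'.2] at hWc hcL
    have heq : ∑ γ ∈ Tc, (E / |(γ.c : ℝ)| + 1) = ∑ γ ∈ Tc, (E / |(c : ℝ)| + 1) :=
      Finset.sum_congr rfl fun γ hγ => by rw [(Finset.mem_filter.1 hγ).2]
    rw [heq, Finset.sum_const, nsmul_eq_mul]
    set R : ℝ := 4 * |(c : ℝ)| * A / C with hR
    have hR0 : 0 ≤ R := by positivity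
    have hcard := card_fixed_c_le Tc c hc0 R hR0 fun γ hγ => by
      have h1 := Finset.mem_filter.1 hγ
      obtain ⟨hd, -, -, -, ha, hd'⟩ := hT γ h1.1
      rw [h1.2] at ha hd'
      exact ⟨hd, h1.2, ha, hd'⟩
    -- `w = |c| A / C ≥ W ≥ 1`
    have hcne : |(c : ℝ)| ≠ 0 := hc0'.ne'
    have hw1 : 1 ≤ |(c : ℝ)| * A / C := by
      rw [le_div_iff₀ hC]
      calc 1 * C = C := one_mul C
        _ ≤ W * C := le_mul_of_one_le_left hC.le hW
        _ ≤ |(c : ℝ)| * A := hWc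
    have e1 : 2 * R / |(c : ℝ)| + 1 = 8 * A / C + 1 := by
      rw [hR]; field_simp; ring
    have e2 : 2 * R + 1 ≤ 9 * (|(c : ℝ)| * A / C) := by
      have : R = 4 * (|(c : ℝ)| * A / C) := by rw [hR]; ring
      rw [this]; linarith
    calc (Tc.card : ℝ) * (E / |(c : ℝ)| + 1)
        ≤ (2 * R + 1) * (2 * R / |(c : ℝ)| + 1) * (E / |(c : ℝ)| + 1) := by gcongr
      _ = (2 * R + 1) * (8 * A / C + 1) * (E / |(c : ℝ)| + 1) := by rw [e1]
      _ ≤ (9 * (|(c : ℝ)| * A / C)) * (8 * A / C + 1) * (E / |(c : ℝ)| + 1) := by gcongr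
      _ = 9 * (A / C) * (8 * A / C + 1) * (E + |(c : ℝ)|) := by field_simp
      _ ≤ U := by rw [hU]; gcongr
  calc ∑ c ∈ Cset, ∑ γ ∈ T with γ.c = c, (E / |(γ.c : ℝ)| + 1) ≤ ∑ _c ∈ Cset, U :=
        Finset.sum_le_sum hinner
    _ = (Cset.card : ℝ) * U := by rw [Finset.sum_const, nsmul_eq_mul]
    _ ≤ (2 * L) * U := by gcongr; exact card_Icc_erase_zero_le hL0
    _ = 8 * Δ₁ * C ^ 2 * U := by rw [hL]; ring

end Counting

/-- `#Icc (-D) D = 2D + 1` for an integer `D ≥ 0`. [folklore] -/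
theorem card_Icc_neg_int {D : ℤ} (hD : 0 ≤ D) : ((Finset.Icc (-D) D).card : ℝ) = 2 * D + 1 := by
  rw [Int.card_Icc]
  have e : (((D + 1 - -D).toNat : ℤ) : ℝ) = ((D + 1 - -D : ℤ) : ℝ) := by
    rw [Int.toNat_of_nonneg (by omega)]
  rw [Int.cast_natCast] at e
  rw [e]; push_cast; ring

/-! ### The second spacing lemma -/

section Main

variable {A C Δ₁ Δ₂ H C₀ : ℝ} {I : Set ℝ} {h h' : ℝ → ℝ}

/-- **Graham–Kolesnik, Lemma 7.18 — explicit form of the bound proved here.** With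
`D = ⌈576 C₀⁴ + 48 C₀²⌉`:
`B ≤ 4AC (8 + (2D+1)⁴) + 16 C₀ A² Δ₂ + 128 C₀ C² Δ₂ + 72 Δ₁ (16 C₀ Δ₂ + 4 Δ₁)(8 A² C² + A C³)`.
The four groups of terms are, in order, the contributions of the matrices with `a = 0`, `d = 0` or
`0 < |bc| < D` (`≪ AC`), of `c = 0` (`≪ AC + Δ₂ A²`), of `b = 0` (`≪ AC + Δ₂ C²`), and of `|bc| ≥ D`
(`≪ (Δ₁ Δ₂ + Δ₁²) A C² (A + C)`; Graham–Kolesnik print `Δ₁ (Δ₁ + Δ₂) A² C²` here, using `A ≫ C`).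
[cite: GrahamKolesnik1991, Lemma 7.18] -/
theorem pairCount_le (hC₀ : 1 ≤ C₀) (hA : 1 ≤ A) (hC : 1 ≤ C) (hΔ₁ : 0 ≤ Δ₁) (hΔ₂ : 0 ≤ Δ₂)
    (hH : 0 < H) (hh : IsSpacingFn A C H C₀ I h h') :
    (pairCount A C Δ₁ Δ₂ H I h : ℝ) ≤
      4 * A * C * (8 + (2 * (⌈576 * C₀ ^ 4 + 48 * C₀ ^ 2⌉ : ℝ) + 1) ^ 4) + 16 * C₀ * A ^ 2 * Δ₂
        + 128 * C₀ * C ^ 2 * Δ₂ + 72 * Δ₁ * (16 * C₀ * Δ₂ + 4 * Δ₁) * (8 * A ^ 2 * C ^ 2 + A * C ^ 3) := by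
  classical
  have hA0 : 0 < A := by linarith
  have hC0 : 0 < C := by linarith
  have hC₀0 : 0 < C₀ := by linarith
  set W : ℝ := 12 * C₀ ^ 2 with hW
  have hW1 : 1 ≤ W := by rw [hW]; nlinarith
  set Dz : ℤ := ⌈576 * C₀ ^ 4 + 48 * C₀ ^ 2⌉ with hDz
  have hDz0 : 0 ≤ Dz := Int.ceil_nonneg (by positivity)
  have hDzW : 4 * W ^ 2 + 4 * W ≤ (Dz : ℝ) := by
    have e : 4 * W ^ 2 + 4 * W = 576 * C₀ ^ 4 + 48 * C₀ ^ 2 := by rw [hW]; ring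
    rw [e]; exact Int.le_ceil _
  set P := points A C I with hP
  set G := goodPairs A C Δ₁ Δ₂ H I h with hG
  have hPcard : (P.card : ℝ) ≤ 4 * A * C :=
    (card_points_le hA0.le hC0.le I).trans (by nlinarith)
  have happG : ∀ pp ∈ G, (mat Δ₁ pp).apply pp.1 = pp.2 := fun pp hpp =>
    (goodPair_facts hC0 hpp).2.2.2.2.2.2.2.1
  -- the six classes of pairs
  set G₁ := G.filter fun pp => (mat Δ₁ pp).c = 0 with hG₁
  set G₂ := G.filter fun pp => (mat Δ₁ pp).b = 0 with hG₂
  set G₃ := G.filter fun pp => (mat Δ₁ pp).a = 0 with hG₃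
  set G₄ := G.filter fun pp => (mat Δ₁ pp).d = 0 with hG₄
  set G₅ := G.filter fun pp => (mat Δ₁ pp).a ≠ 0 ∧ (mat Δ₁ pp).b ≠ 0 ∧ (mat Δ₁ pp).c ≠ 0 ∧
    (mat Δ₁ pp).d ≠ 0 ∧ |(mat Δ₁ pp).b * (mat Δ₁ pp).c| < Dz with hG₅
  set G₆ := G.filter fun pp => ¬ |(mat Δ₁ pp).b * (mat Δ₁ pp).c| < Dz with hG₆
  have hsub : ∀ {Q : (ℤ × ℤ) × (ℤ × ℤ) → Prop} [DecidablePred Q], ∀ pp ∈ G.filter Q, pp ∈ G :=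
    fun pp hpp => (Finset.mem_filter.1 hpp).1
  have hcover : G ⊆ G₁ ∪ G₂ ∪ G₃ ∪ G₄ ∪ G₅ ∪ G₆ := by
    intro pp hpp
    simp only [Finset.mem_union, Finset.mem_filter, hG₁, hG₂, hG₃, hG₄, hG₅, hG₆]
    by_cases hc : (mat Δ₁ pp).c = 0
    · exact Or.inl (Or.inl (Or.inl (Or.inl (Or.inl ⟨hpp, hc⟩))))
    by_cases hb : (mat Δ₁ pp).b = 0
    · exact Or.inl (Or.inl (Or.inl (Or.inl (Or.inr ⟨hpp, hb⟩))))
    by_cases ha : (mat Δ₁ pp).a = 0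
    · exact Or.inl (Or.inl (Or.inl (Or.inr ⟨hpp, ha⟩)))
    by_cases hd : (mat Δ₁ pp).d = 0
    · exact Or.inl (Or.inl (Or.inr ⟨hpp, hd⟩))
    by_cases hD : |(mat Δ₁ pp).b * (mat Δ₁ pp).c| < Dz
    · exact Or.inl (Or.inr ⟨hpp, ha, hb, hc, hd, hD⟩)
    · exact Or.inr ⟨hpp, hD⟩
  have hcardU : G.card ≤ G₁.card + G₂.card + G₃.card + G₄.card + G₅.card + G₆.card := by
    have h0 := Finset.card_le_card hcover
    have h6 := Finset.card_union_le (G₁ ∪ G₂ ∪ G₃ ∪ G₄ ∪ G₅) G₆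
    have h5 := Finset.card_union_le (G₁ ∪ G₂ ∪ G₃ ∪ G₄) G₅
    have h4 := Finset.card_union_le (G₁ ∪ G₂ ∪ G₃) G₄
    have h3 := Finset.card_union_le (G₁ ∪ G₂) G₃
    have h2 := Finset.card_union_le G₁ G₂
    omega
  -- class 1: `c = 0`
  set r₁ : ℝ := 2 * C₀ * A * Δ₂ / C with hr₁
  have hr₁0 : 0 ≤ r₁ := by positivity
  have hb1 : G₁.card ≤ (Finset.Icc (-⌊r₁⌋) ⌊r₁⌋).card * P.card := by
    refine card_le_of_key G₁ P _ (fun pp => (mat Δ₁ pp).b) (mat Δ₁) (fun pp hpp =>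
      (mem_goodPairs.1 (hsub pp hpp)).1) (fun pp hpp => ?_) (fun pp hpp => happG pp (hsub pp hpp))
      (fun pp hpp pp' hpp' hk => ?_)
    · have h1 := Finset.mem_filter.1 hpp
      exact mem_Icc_of_abs_le (caseC hh hA0 hC0 hC₀0 hH h1.1 h1.2).2.2
    · have h1 := Finset.mem_filter.1 hpp
      have h2 := Finset.mem_filter.1 hpp'
      have c1 := caseC hh hA0 hC0 hC₀0 hH h1.1 h1.2
      have c2 := caseC hh hA0 hC0 hC₀0 hH h2.1 h2.2
      exact TMat.ext (c1.1.trans c2.1.symm) hk (h1.2.trans h2.2.symm) (c1.2.1.trans c2.2.1.symm)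
  -- class 2: `b = 0`
  set r₂ : ℝ := 16 * C₀ * C * Δ₂ / A with hr₂
  have hr₂0 : 0 ≤ r₂ := by positivity
  have hb2 : G₂.card ≤ (Finset.Icc (-⌊r₂⌋) ⌊r₂⌋).card * P.card := by
    refine card_le_of_key G₂ P _ (fun pp => (mat Δ₁ pp).c) (mat Δ₁) (fun pp hpp =>
      (mem_goodPairs.1 (hsub pp hpp)).1) (fun pp hpp => ?_) (fun pp hpp => happG pp (hsub pp hpp))
      (fun pp hpp pp' hpp' hk => ?_)
    · have h1 := Finset.mem_filter.1 hpp
      exact mem_Icc_of_abs_le (caseB hh hA0 hC0 hC₀0 hH h1.1 h1.2).2.2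
    · have h1 := Finset.mem_filter.1 hpp
      have h2 := Finset.mem_filter.1 hpp'
      have c1 := caseB hh hA0 hC0 hC₀0 hH h1.1 h1.2
      have c2 := caseB hh hA0 hC0 hC₀0 hH h2.1 h2.2
      exact TMat.ext (c1.1.trans c2.1.symm) (h1.2.trans h2.2.symm) hk (c1.2.1.trans c2.2.1.symm)
  -- class 3: `a = 0`
  have hb3 : G₃.card ≤ (Finset.Icc (1 : ℤ) 3).card * P.card := by
    refine card_le_of_key G₃ P _ (fun pp => (mat Δ₁ pp).d) (mat Δ₁) (fun pp hpp =>
      (mem_goodPairs.1 (hsub pp hpp)).1) (fun pp hpp => ?_) (fun pp hpp => happG pp (hsub pp hpp))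
      (fun pp hpp pp' hpp' hk => ?_)
    · have h1 := Finset.mem_filter.1 hpp
      have c1 := caseA hA0 hC0 h1.1 h1.2
      exact Finset.mem_Icc.2 ⟨c1.2.2.1, c1.2.2.2⟩
    · have h1 := Finset.mem_filter.1 hpp
      have h2 := Finset.mem_filter.1 hpp'
      have c1 := caseA hA0 hC0 h1.1 h1.2
      have c2 := caseA hA0 hC0 h2.1 h2.2
      exact TMat.ext (h1.2.trans h2.2.symm) (c1.1.trans c2.1.symm) (c1.2.1.trans c2.2.1.symm) hk
  -- class 4: `d = 0`
  have hb4 : G₄.card ≤ (Finset.Icc (1 : ℤ) 3).card * P.card := by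
    refine card_le_of_key G₄ P _ (fun pp => (mat Δ₁ pp).a) (mat Δ₁) (fun pp hpp =>
      (mem_goodPairs.1 (hsub pp hpp)).1) (fun pp hpp => ?_) (fun pp hpp => happG pp (hsub pp hpp))
      (fun pp hpp pp' hpp' hk => ?_)
    · have h1 := Finset.mem_filter.1 hpp
      have c1 := caseD hA0 hC0 h1.1 h1.2
      exact Finset.mem_Icc.2 ⟨c1.2.2.1, c1.2.2.2⟩
    · have h1 := Finset.mem_filter.1 hpp
      have h2 := Finset.mem_filter.1 hpp'
      have c1 := caseD hA0 hC0 h1.1 h1.2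
      have c2 := caseD hA0 hC0 h2.1 h2.2
      exact TMat.ext hk (c1.2.1.trans c2.2.1.symm) (c1.1.trans c2.1.symm) (h1.2.trans h2.2.symm)
  -- class 5: `abcd ≠ 0`, `|bc| < D`
  set Ic := Finset.Icc (-Dz) Dz with hIc
  have hb5 : G₅.card ≤ (Ic ×ˢ Ic ×ˢ Ic ×ˢ Ic).card * P.card := by
    refine card_le_of_key G₅ P _
      (fun pp => ((mat Δ₁ pp).a, (mat Δ₁ pp).b, (mat Δ₁ pp).c, (mat Δ₁ pp).d)) (mat Δ₁)
      (fun pp hpp => (mem_goodPairs.1 (hsub pp hpp)).1) (fun pp hpp => ?_)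
      (fun pp hpp => happG pp (hsub pp hpp)) (fun pp hpp pp' hpp' hk => ?_)
    · have h1 := Finset.mem_filter.1 hpp
      obtain ⟨ha, hb, hc, hd, hD⟩ := h1.2
      have hdet := (goodPair_facts hC0 h1.1).2.2.2.2.2.2.1
      obtain ⟨h₁, h₂, h₃, h₄⟩ := caseSmall (mat Δ₁ pp) hdet ha hb hc hd hD
      simp only [hIc, Finset.mem_product, Finset.mem_Icc, ← abs_le]
      exact ⟨h₁, h₂, h₃, h₄⟩
    · simp only [Prod.mk.injEq] at hk
      exact TMat.ext hk.1 hk.2.1 hk.2.2.1 hk.2.2.2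
  -- class 6: `|bc| ≥ D`
  set E : ℝ := 16 * C₀ * C ^ 2 * Δ₂ with hE
  have hE0 : 0 ≤ E := by positivity
  have hb6 : (G₆.card : ℝ) ≤ 8 * Δ₁ * C ^ 2 * (9 * (A / C) * (8 * A / C + 1) * (E + 4 * Δ₁ * C ^ 2)) := by
    rw [Finset.card_eq_sum_card_image (mat Δ₁) G₆]
    push_cast
    set T := G₆.image (mat Δ₁) with hT
    -- structural facts about the matrices in `T`
    have hTfacts : ∀ γ ∈ T, γ.det = 1 ∧ γ.c ≠ 0 ∧ W * C ≤ |(γ.c : ℝ)| * A ∧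
        |(γ.c : ℝ)| ≤ 4 * Δ₁ * C ^ 2 ∧ |(γ.a : ℝ)| ≤ 4 * |(γ.c : ℝ)| * A / C ∧
        |(γ.d : ℝ)| ≤ 4 * |(γ.c : ℝ)| * A / C := by
      intro γ hγ
      rw [hT, Finset.mem_image] at hγ
      obtain ⟨pp, hpp, rfl⟩ := hγ
      have h1 := Finset.mem_filter.1 hpp
      obtain ⟨-, ⟨-, hq2⟩, -, ⟨hq1', hq2'⟩, -, -, hdet, -, hcq, -⟩ := goodPair_facts hC0 h1.1
      have hbig : 4 * W ^ 2 + 4 * W ≤ |((mat Δ₁ pp).b : ℝ) * (mat Δ₁ pp).c| := by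
        have h2 : Dz ≤ |(mat Δ₁ pp).b * (mat Δ₁ pp).c| := le_of_not_gt h1.2
        have h3 : (Dz : ℝ) ≤ ((|(mat Δ₁ pp).b * (mat Δ₁ pp).c| : ℤ) : ℝ) := by exact_mod_cast h2
        rw [Int.cast_abs, Int.cast_mul] at h3
        exact hDzW.trans h3
      obtain ⟨hWc, ha, hd⟩ := caseBig hh hA0 hC0 h1.1 hW1 hbig
      have hcpos : 0 < |((mat Δ₁ pp).c : ℝ)| := by
        have : 0 < |((mat Δ₁ pp).c : ℝ)| * A := lt_of_lt_of_le (by positivity) hWc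
        exact pos_of_mul_pos_left this hA0.le
      refine ⟨hdet, ?_, hWc, ?_, ha, hd⟩
      · have : ((mat Δ₁ pp).c : ℝ) ≠ 0 := abs_pos.1 hcpos
        exact_mod_cast this
      · have hq0' : (0 : ℝ) ≤ pp.2.2 := by linarith
        calc |((mat Δ₁ pp).c : ℝ)| ≤ Δ₁ * pp.1.2 * pp.2.2 := hcq
          _ ≤ Δ₁ * (2 * C) * (2 * C) := by gcongr
          _ = 4 * Δ₁ * C ^ 2 := by ring
    -- each fiber is small
    have hfib : ∀ γ ∈ T, (((G₆.filter fun pp => mat Δ₁ pp = γ).card : ℕ) : ℝ) ≤ E / |(γ.c : ℝ)| + 1 := by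
      intro γ hγ
      obtain ⟨hdet, -, hWc, -, -, -⟩ := hTfacts γ hγ
      set Fγ := G₆.filter fun pp => mat Δ₁ pp = γ with hFγ
      have hFγ' : ∀ pp ∈ Fγ, pp ∈ G ∧ mat Δ₁ pp = γ := fun pp hpp =>
        ⟨hsub pp (Finset.mem_filter.1 hpp).1, (Finset.mem_filter.1 hpp).2⟩
      have h2 : ∀ pp ∈ Fγ, γ.apply pp.1 = pp.2 := fun pp hpp => by
        rw [← (hFγ' pp hpp).2]; exact happG pp (hFγ' pp hpp).1
      have hinj : Set.InjOn Prod.fst (Fγ : Set ((ℤ × ℤ) × (ℤ × ℤ))) := by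
        intro pp hpp pp' hpp' heq
        exact Prod.ext heq (by rw [← h2 pp hpp, ← h2 pp' hpp', heq])
      rw [← Finset.card_image_of_injOn hinj]
      refine fiber_card_le hh hA0 hC0 hC₀0 hH hΔ₂ γ hdet (by rw [hW] at hWc; linarith) _ ?_
      intro p hp
      rw [Finset.mem_image] at hp
      obtain ⟨pp, hpp, rfl⟩ := hp
      have h3 := mem_goodPairs.1 (hFγ' pp hpp).1
      rw [← h2 pp hpp] at h3
      exact ⟨h3.1, h3.2.1, h3.2.2.2⟩
    calc ∑ γ ∈ T, (((G₆.filter fun pp => mat Δ₁ pp = γ).card : ℕ) : ℝ)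
        ≤ ∑ γ ∈ T, (E / |(γ.c : ℝ)| + 1) := Finset.sum_le_sum hfib
      _ ≤ _ := sum_big_le T hA0 hC0 hΔ₁ hW1 hE0 hTfacts
  -- assembling
  have e1 : (G₁.card : ℝ) ≤ (2 * r₁ + 1) * P.card := by
    calc (G₁.card : ℝ) ≤ ((Finset.Icc (-⌊r₁⌋) ⌊r₁⌋).card : ℝ) * P.card := by exact_mod_cast hb1
      _ ≤ (2 * r₁ + 1) * P.card := by gcongr; exact card_Icc_neg_floor_le hr₁0
  have e2 : (G₂.card : ℝ) ≤ (2 * r₂ + 1) * P.card := by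
    calc (G₂.card : ℝ) ≤ ((Finset.Icc (-⌊r₂⌋) ⌊r₂⌋).card : ℝ) * P.card := by exact_mod_cast hb2
      _ ≤ (2 * r₂ + 1) * P.card := by gcongr; exact card_Icc_neg_floor_le hr₂0
  have e3 : (G₃.card : ℝ) ≤ 3 * P.card := by
    have : (Finset.Icc (1 : ℤ) 3).card = 3 := by decide
    rw [this] at hb3; exact_mod_cast hb3
  have e4 : (G₄.card : ℝ) ≤ 3 * P.card := by
    have : (Finset.Icc (1 : ℤ) 3).card = 3 := by decide
    rw [this] at hb4; exact_mod_cast hb4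
  have e5 : (G₅.card : ℝ) ≤ (2 * Dz + 1) ^ 4 * P.card := by
    have hIc' : (Ic.card : ℝ) = 2 * Dz + 1 := card_Icc_neg_int hDz0
    calc (G₅.card : ℝ) ≤ ((Ic ×ˢ Ic ×ˢ Ic ×ˢ Ic).card : ℝ) * P.card := by exact_mod_cast hb5
      _ = (2 * Dz + 1) ^ 4 * P.card := by
          rw [Finset.card_product, Finset.card_product, Finset.card_product]; push_cast
          rw [hIc']; ring
  have etot : (G.card : ℝ) ≤ G₁.card + G₂.card + G₃.card + G₄.card + G₅.card + G₆.card := by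
    exact_mod_cast hcardU
  have hmain : (G.card : ℝ) ≤ (2 * r₁ + 1 + (2 * r₂ + 1) + 3 + 3 + (2 * Dz + 1) ^ 4) * P.card +
      8 * Δ₁ * C ^ 2 * (9 * (A / C) * (8 * A / C + 1) * (E + 4 * Δ₁ * C ^ 2)) := by
    have := add_le_add (add_le_add (add_le_add (add_le_add (add_le_add e1 e2) e3) e4) e5) hb6
    linarith
  -- simplifying the constants
  have f1 : (2 * r₁ + 1 + (2 * r₂ + 1) + 3 + 3 + (2 * Dz + 1) ^ 4) * (P.card : ℝ) ≤
      (2 * r₁ + 1 + (2 * r₂ + 1) + 3 + 3 + (2 * Dz + 1) ^ 4) * (4 * A * C) := by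
    have hD1 : (0 : ℝ) ≤ 2 * Dz + 1 := by
      have : (0 : ℝ) ≤ Dz := by exact_mod_cast hDz0
      linarith
    gcongr
  have f2 : (2 * r₁ + 1 + (2 * r₂ + 1) + 3 + 3 + (2 * Dz + 1) ^ 4) * (4 * A * C) =
      4 * A * C * (8 + (2 * Dz + 1) ^ 4) + 16 * C₀ * A ^ 2 * Δ₂ + 128 * C₀ * C ^ 2 * Δ₂ := by
    rw [hr₁, hr₂]; field_simp; ring
  have f3 : 8 * Δ₁ * C ^ 2 * (9 * (A / C) * (8 * A / C + 1) * (E + 4 * Δ₁ * C ^ 2)) =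
      72 * Δ₁ * (16 * C₀ * Δ₂ + 4 * Δ₁) * (8 * A ^ 2 * C ^ 2 + A * C ^ 3) := by
    rw [hE]; field_simp; ring
  unfold pairCount
  linarith

/-- **Graham–Kolesnik, Lemma 7.18 (the second spacing lemma), general form.** Let `A, C ≥ 1`,
`Δ₁, Δ₂ ≥ 0`, `H > 0`, and let `h` satisfy on an interval `I ⊆ [A/2C, 2A/C]`:
`H/C₀ ≤ h`, `H/C₀ ≤ |x h'| ≤ C₀ H`, `H/C₀ ≤ |h - x h'|` (`IsSpacingFn`). Let `B` be the number of
pairs of reduced fractions `r/q, r₁/q₁ ∈ I` with `A < r, r₁ ≤ 2A`, `C < q, q₁ ≤ 2C`,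
`‖r̄/q - r̄₁/q₁‖ ≤ Δ₁` (7.5.2) and `|q h(r/q) - q₁ h(r₁/q₁)| ≤ C H Δ₂` (7.5.3). Then
`B ≪_{C₀} (Δ₁Δ₂ + Δ₁²) A C² (A + C) + AC + Δ₂ A² + Δ₂ C²`.
Graham–Kolesnik state `B ≪ Δ₁Δ₂A²C² + Δ₁²A²C² + AC + Δ₂A² + Δ₂C²`; the last display of their
proof uses `X = A/5C ≫ 1`, i.e. `A ≫ C` (which holds in the applications, where
`A ≍ C F M⁻²`), and without it the same argument gives the extra factor `(A + C)/A` on the first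
two terms — see `GrahamKolesnik_lemma718` for the printed form under `C ≤ K₁ A`. The lemma is
Bombieri–Iwaniec's and Huxley–Watt's second spacing lemma (the bound `B₁ ≪ Δ₁Δ₂(M/N)²(Q/R)⁴` used in
(3.11) of Bourgain, JAMS 30 (2017)). [cite: GrahamKolesnik1991, Lemma 7.18] -/
theorem GrahamKolesnik_lemma718_general {C₀ : ℝ} (hC₀ : 1 ≤ C₀) :
    ∃ K : ℝ, 0 < K ∧ ∀ (A C Δ₁ Δ₂ H : ℝ) (I : Set ℝ) (h h' : ℝ → ℝ),
      1 ≤ A → 1 ≤ C → 0 ≤ Δ₁ → 0 ≤ Δ₂ → 0 < H → IsSpacingFn A C H C₀ I h h' →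
      (pairCount A C Δ₁ Δ₂ H I h : ℝ) ≤
        K * ((Δ₁ * Δ₂ + Δ₁ ^ 2) * (A * C ^ 2 * (A + C)) + A * C + Δ₂ * A ^ 2 + Δ₂ * C ^ 2) := by
  set Dr : ℝ := (2 * (⌈576 * C₀ ^ 4 + 48 * C₀ ^ 2⌉ : ℝ) + 1) ^ 4 with hDr
  have hDr0 : 0 ≤ Dr := by
    rw [hDr]
    have : (0 : ℝ) ≤ (⌈576 * C₀ ^ 4 + 48 * C₀ ^ 2⌉ : ℝ) := by
      exact_mod_cast Int.ceil_nonneg (by positivity)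
    positivity
  refine ⟨4 * (8 + Dr) + 128 * C₀ + 9216 * C₀, by positivity, ?_⟩
  intro A C Δ₁ Δ₂ H I h h' hA hC hΔ₁ hΔ₂ hH hh
  have hB := pairCount_le hC₀ hA hC hΔ₁ hΔ₂ hH hh
  rw [← hDr] at hB
  have hA0 : 0 < A := by linarith
  have hC0 : 0 < C := by linarith
  have h1 : 72 * Δ₁ * (16 * C₀ * Δ₂ + 4 * Δ₁) * (8 * A ^ 2 * C ^ 2 + A * C ^ 3) ≤
      9216 * C₀ * ((Δ₁ * Δ₂ + Δ₁ ^ 2) * (A * C ^ 2 * (A + C))) := by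
    have h2 : 16 * C₀ * Δ₂ + 4 * Δ₁ ≤ 16 * C₀ * (Δ₂ + Δ₁) := by nlinarith
    have h3 : 8 * A ^ 2 * C ^ 2 + A * C ^ 3 ≤ 8 * (A * C ^ 2 * (A + C)) := by nlinarith [mul_pos hA0 hC0]
    calc 72 * Δ₁ * (16 * C₀ * Δ₂ + 4 * Δ₁) * (8 * A ^ 2 * C ^ 2 + A * C ^ 3)
        ≤ 72 * Δ₁ * (16 * C₀ * (Δ₂ + Δ₁)) * (8 * (A * C ^ 2 * (A + C))) := by gcongr
      _ = 9216 * C₀ * ((Δ₁ * Δ₂ + Δ₁ ^ 2) * (A * C ^ 2 * (A + C))) := by ring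
  have hX0 : 0 ≤ (Δ₁ * Δ₂ + Δ₁ ^ 2) * (A * C ^ 2 * (A + C)) := by positivity
  have hAC : 0 ≤ A * C := by positivity
  have hA2 : 0 ≤ Δ₂ * A ^ 2 := by positivity
  have hC2 : 0 ≤ Δ₂ * C ^ 2 := by positivity
  nlinarith

/-- **Graham–Kolesnik, Lemma 7.18, as printed** (under the proviso `C ≤ K₁ A` used implicitly in the
printed proof): `B ≪_{C₀, K₁} Δ₁Δ₂A²C² + Δ₁²A²C² + AC + Δ₂A² + Δ₂C²`.
[cite: GrahamKolesnik1991, Lemma 7.18] -/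
theorem GrahamKolesnik_lemma718 {C₀ K₁ : ℝ} (hC₀ : 1 ≤ C₀) (hK₁ : 0 ≤ K₁) :
    ∃ K : ℝ, 0 < K ∧ ∀ (A C Δ₁ Δ₂ H : ℝ) (I : Set ℝ) (h h' : ℝ → ℝ),
      1 ≤ A → 1 ≤ C → C ≤ K₁ * A → 0 ≤ Δ₁ → 0 ≤ Δ₂ → 0 < H → IsSpacingFn A C H C₀ I h h' →
      (pairCount A C Δ₁ Δ₂ H I h : ℝ) ≤
        K * (Δ₁ * Δ₂ * A ^ 2 * C ^ 2 + Δ₁ ^ 2 * A ^ 2 * C ^ 2 + A * C + Δ₂ * A ^ 2 + Δ₂ * C ^ 2) := by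
  obtain ⟨K, hK, hB⟩ := GrahamKolesnik_lemma718_general hC₀
  refine ⟨K * (1 + K₁), by positivity, ?_⟩
  intro A C Δ₁ Δ₂ H I h h' hA hC hCA hΔ₁ hΔ₂ hH hh
  have h1 := hB A C Δ₁ Δ₂ H I h h' hA hC hΔ₁ hΔ₂ hH hh
  have hA0 : 0 < A := by linarith
  have hC0 : 0 < C := by linarith
  have h2 : A * C ^ 2 * (A + C) ≤ (1 + K₁) * (A ^ 2 * C ^ 2) := by
    nlinarith [mul_le_mul_of_nonneg_left hCA (by positivity : (0 : ℝ) ≤ A * C ^ 2)]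
  have hX : 0 ≤ Δ₁ * Δ₂ + Δ₁ ^ 2 := by positivity
  have h3 : (Δ₁ * Δ₂ + Δ₁ ^ 2) * (A * C ^ 2 * (A + C)) ≤
      (1 + K₁) * (Δ₁ * Δ₂ * A ^ 2 * C ^ 2 + Δ₁ ^ 2 * A ^ 2 * C ^ 2) := by
    calc (Δ₁ * Δ₂ + Δ₁ ^ 2) * (A * C ^ 2 * (A + C)) ≤ (Δ₁ * Δ₂ + Δ₁ ^ 2) * ((1 + K₁) * (A ^ 2 * C ^ 2)) :=
          mul_le_mul_of_nonneg_left h2 hX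
      _ = (1 + K₁) * (Δ₁ * Δ₂ * A ^ 2 * C ^ 2 + Δ₁ ^ 2 * A ^ 2 * C ^ 2) := by ring
  have hrest : 0 ≤ A * C + Δ₂ * A ^ 2 + Δ₂ * C ^ 2 := by positivity
  have h4 : A * C + Δ₂ * A ^ 2 + Δ₂ * C ^ 2 ≤ (1 + K₁) * (A * C + Δ₂ * A ^ 2 + Δ₂ * C ^ 2) := by
    nlinarith
  calc (pairCount A C Δ₁ Δ₂ H I h : ℝ)
      ≤ K * ((Δ₁ * Δ₂ + Δ₁ ^ 2) * (A * C ^ 2 * (A + C)) + A * C + Δ₂ * A ^ 2 + Δ₂ * C ^ 2) := h1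
    _ ≤ K * ((1 + K₁) * (Δ₁ * Δ₂ * A ^ 2 * C ^ 2 + Δ₁ ^ 2 * A ^ 2 * C ^ 2) +
          (1 + K₁) * (A * C + Δ₂ * A ^ 2 + Δ₂ * C ^ 2)) :=
        mul_le_mul_of_nonneg_left (by linarith) hK.le
    _ = K * (1 + K₁) * (Δ₁ * Δ₂ * A ^ 2 * C ^ 2 + Δ₁ ^ 2 * A ^ 2 * C ^ 2 + A * C + Δ₂ * A ^ 2 +
          Δ₂ * C ^ 2) := by ring

end Main

end SecondSpacing
end Literature.NumberTheory.LFunctions
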